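import Mathlib
import Literature.MathematicalPhysics.QuantumFieldTheory.Balaban1983to89.T4InputCauchyRateSpecies
import Literature.Analysis.Complex.HolomorphicParametricIntegral

/-!
# T4InputCauchyRateTermwise — the TERMWISE KERNEL of the class reading: the output of a step map that is, at every point
# of an admissible input class, the sum of a CONVERGENT EXPANSION whose terms are entire along complex segments inside the
# class and are dominated term by term by a summable, class-uniform majorant, IS — with any room `r > 1` around the slack
# box — the pair of fibre envelopes of `T4InputCauchyRateData` §11, hence feeds the species closure of
# `T4InputCauchyRateSpecies` unchanged, and — file v1.1, §4: WITH NO ROOM AT ALL — the pair of weaker `DiffContOnCl`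
# fibre envelopes, which feed the same closure with the same smallness and constant (the M-test's honest output,
# differentiable inside the unit disc and continuous up to its boundary, is all the Cauchy legs use) — and, file v1.2,
# §6: with the per-term analyticity in the HISTORY species DISCHARGED from the printed STRUCTURE of the resummed term
# (potentials only through the exponential of a linear functional, integrated against potential-independent data:
# holomorphy under the integral sign, no room, no strip); the seat's technique
# in its LITERAL form (differentiate the expansion term-wise, bound each derivative by Cauchy's estimate on the analyticity
# strip, sum the majorants); and NON-VOID end-to-end instances on a toy whose output is a genuine power series
# (`exp(o + h) − 1` through its Taylor terms)
# (cell `pub-balaban`, T⁴-continuum fan-out, node U3 / spine estimate NE5, prover seat P1 = "cluster-expansion derivative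
# bound: differentiate B13's convergent expansion in V and bound term-wise (analyticity strip ⇒ Cauchy estimate)"; a SIBLING
# LEAF of `T4InputCauchyRateSpecies` (file v1.4, frozen), which it imports BY NAME and does not modify)

HONEST FRAMING.  The cell's T4 target is rung (B)+1 (existence AND uniqueness of the ε → 0 limit of Bałaban's unit-scale
expectations on a FIXED finite torus T⁴); NOT infinite volume, NOT a mass gap, NOT the Clay problem.  The conditionals of the
spine (BetaPertH, (B), (B^μ)) are untouched by this module and stay explicit wherever the spine composes (`T4OutputRate`
docstring; T4-DAG §2).  NOTHING printed in the audited papers is asserted here: `TermRep`, `TermBound`, `TermBudget`,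
`TermLineAnalytic` below are HYPOTHESIS SHAPES over the hypothesis-carrying data `T4InputCauchyRateData.StepModel` and the
ABSTRACT carriers of `T4OutputRate` (to be ASSUMED by consumers, never cited as facts); every `theorem` is kernel-checked
complex analysis (Weierstrass M-test, termwise differentiation, Cauchy's estimate — Mathlib's
`Complex.differentiableOn_tsum_of_summable_norm`, `Complex.hasSum_deriv_of_summable_norm`,
`Complex.norm_deriv_le_of_forall_mem_sphere_norm_le`), real bookkeeping about the shapes of the two imported leaves, and a
toy.  The estimate NE5 itself is NOT PRINTED anywhere in [Balaban1987RG1], [Balaban1988RG2Cluster], [Balaban1988Convergent]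
(cell GAPS G-t4-U3-1); this module does not change that, derives no expansion, majorant or modulus of any actual step map,
and changes NO census value of `T4InputCauchyRateSpecies` NUMBERS (f)/(g″) (file v1 booked one factor `r ↓ 1⁺` for the room,
(β) below; §4 of file v1.1 removes it — no room, no factor).

WHAT THIS LEAF DOES (successor menu of the cell record `t4/T4-EST-NE5-P1.md` v12 §29; cell wall sheet `WALLS-NE5-P1.md` v7.1,
row W2-hist/LINE).  After file v1.4 of `T4InputCauchyRateSpecies` the output side of the seat's NE5 route rests on three
hypothesis shapes over an admissible input class `K`: `ClassBound K κ G` (the one-run envelope at EVERY class point — the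
interface reading of [II] §2, certified by reading), `BoxInClass K` (the slack — discharged from the printed budget by
dilation, §8 there) and `ClassLineAnalytic K` (complex differentiability of the output along complex segments inside the
class, on the CLOSED unit disc — [analysis] of the printed structure, row LINE of the wall sheet, the last output-side
[analysis] item without a kernel face).  The seat's assigned technique says where LINE should come from: the output IS a
convergent expansion — [II] p. 14 defines `𝐄^{(k+1)}(X)` by the series (2.13) and announces [R] *"In the rest of this section
we will prove bounds and discuss analyticity properties of the functions (2.13)."*; p. 20 [R] *"The above lemma implies that
sufficient conditions for convergence of the series (2.12), (2.13) are satisfied, see [26, 67, 25, 50]."* and [R] *"The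
series (2.13), defining 𝐄^{(k+1)}(X), is estimated in the standard way, each factor |H(Z)| is replaced by the right-hand side
of (2.38) in the bound."* — i.e. the printed bound (2.41) p. 21 IS a termwise majorant bound; and p. 15 derives the
analyticity of the SUM from that of the TERMS [R] *"Thus the activities in (2.13), and the whole sum 𝐄^{(k+1)}(X), are
analytic functions of (𝐔, 𝐉), on the space 𝐔^c_{k+1}(X, α₀, α₁). This is the analyticity statement in the inductive
assumptions."* (in the background fields `(𝐔, 𝐉)`; for the complex parameters the mechanism is p. 5 [R] *"To estimate a term
in the sum (1.10) we use the Cauchy formula, hence we have to investigate analyticity properties of the functions 𝐄(⋯) with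
respect to the variables s(Y₀)."*).  This leaf types exactly that mechanism, abstractly: §1 is the technique in its literal
form (pure complex analysis on a disc: the termwise DERIVATIVE of a majorised expansion exists and is bounded term by term by
Cauchy's estimate on the strip, `norm_deriv_tsum_le_of_majorant`; the sum is complex differentiable on the open disc and
bounded by the sum of the majorants); §2 types the four TERMWISE hypothesis shapes over a `StepModel` and an input class `K`
and PROVES: `TermRep ∧ TermBound ∧ TermBudget ⟹ ClassBound` (`classBound_of_termwise`); `… ∧ TermLineAnalytic ⟹` complex
differentiability of the output along every complex segment whose closed unit part lies in the class, on the OPEN unit disc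
(`differentiableOn_ball_of_termwise` — the honest output of the M-test: termwise closed-disc differentiability with a
summable sup-majorant does NOT give closed-disc differentiability of the sum, e.g. `Σ ζⁿ/n²`; room is needed for THAT — but,
§4 of file v1.1, not for the route: the sum is also CONTINUOUS on the closed disc, and `DiffContOnCl` is all the Cauchy legs
use); and, granting ROOM `r > 1` — the `r`-DILATED two-margin box around every base point lies in the class, `BoxInClass
(regauge M r r) K` — BOTH fibre envelopes of `T4InputCauchyRateData` §11 with the class constant `G` and the model's OWN
margins (`opFibreEnvelope_of_termwise`, `histFibreEnvelope_of_termwise`: the unit segment in margin units is the `1/r`-part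
of the dilated segment, on whose open unit disc the sum is differentiable), whence the species closure of
`T4InputCauchyRateSpecies` §2 UNCHANGED (`ne5_at_of_stepModel_termwise_scale_nat`, and with the slack from budget + room,
`ne5_at_of_stepModel_termwise_budget_scale_nat`: room inequalities `BOp + r·rOp ≤ ROp`, `BHist + r·rHist ≤ RHist`); §3 is a
NON-VOID end-to-end instance on a toy whose output `exp(o + h) − 1` is represented by its Taylor terms `(o + h)^{i+1}/(i+1)!`
with the factorial majorants `R^{i+1}/(i+1)!` on the ball class of radius `R` (`toyE_ne5_termwise`, rate `1/2`).

THE PRICE, HONESTLY (the only census consequence; cell wall sheet row LINE).  (α) What the termwise reading RELOCATES: the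
[analysis] content of `ClassLineAnalytic` moves to `TermLineAnalytic` — EACH TERM of the expansion is complex differentiable
(on the closed unit disc) along complex segments in (operators, potentials) inside the class.  Printed support for the
potentials: the STRUCTURE of the resummed term (2.14) p. 15, whose last factor is [R] *"exp[Σ_{Y∈𝐃} τ(Y)𝐕_k(Y,B)]"* — the
potentials enter each term ONLY through the exponential of a `τ`-linear combination, so along a complex segment `V + ζv` the
integrand is `exp` of an affine function of `ζ` ([analysis]: entire, granted locally uniform convergence of the `B`-integrals
under the characteristic functions — NOT PRINTED as a statement); for the operators: the `s(Y₀)`/`σ(Δ)` analyticity of p.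
5/p. 15 ([analysis] as in `T4InputCauchyRateData.StepModel.OpFibreEnvelope`'s docstring).  `TermRep` on the whole class and
`TermBound`/`TermBudget` are the CLASS reading again (the expansion and its termwise majorants hold for every admissible
input — certified for (2.41) by the lineage's reading of [II] §2, `READING-W2-CLASS-CERT.md`; NOT PRINTED as statements
quantified over a class `K`).  (β) [File v1's booking, VOIDED by §4 of file v1.1 and kept only as the record of the
closed-disc route — the two-point bound needs differentiability INSIDE the disc and continuity UP TO the boundary,
`norm_sub_le_of_diffContOnCl_near`, and the termwise data give both at `r = 1`:] What it COSTS: room `r > 1`, ANY `r > 1`,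
strictly — at `r = 1` the termwise data give the open unit disc only, on which the unit-disc Cauchy two-point bound of
`T4InputCauchyRateData` (`norm_sub_le_of_unitDisc_near`, stated for closed-disc differentiability) has nothing to stand on.
In the budget/dilation currency of `T4InputCauchyRateSpecies` NUMBERS (g″) (class radius `λE₀`, budget `μE₀`, `μ ≤ 1`
printed) the room inequality becomes `μE₀ + r·rHist ≤ λE₀`, i.e. `rHist = (λ − μ)E₀/r`: the natural history gain `c =
γ₀/rHist` and with it the exponent-critical product pick up the factor `r` — `ν_eff ↦ r·ν_eff = rλν/(λ − μ)` — and the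
operator reach `δ ↦ rδ` (paid in `k₀`/`B` only).  Since every `r > 1` is admissible the infimum of the price is the (g″)
census itself, NOT ATTAINED: e.g. `r = 1 + 10⁻³` changes no tabulated digit of (g″).  Nothing else moves: CLASS (certified by
reading, not a printed sentence), SLACK (budget + dilation), the operator species (constant-only), `DataLipschitz`
(corresponds to nothing printed), NE5 NOT PRINTED (G-t4-U3-1).

NO ROOM (file v1.1, ADDITIVE §4–§5; generation 10, same claim).  The legs of the species closure
(`T4InputCauchyRateSpecies.opLeg_of_opFibreEnvelope`, `histLeg_of_histFibreEnvelope`) use a fibre envelope ONLY through the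
unit-disc two-point Cauchy bound, and that bound needs the segment function complex differentiable on the OPEN unit disc and
CONTINUOUS on the closed one (Mathlib's `DiffContOnCl`), with the envelope on the closed disc: Cauchy's estimate on the disc
of radius `1 − ρ₀` about each point of modulus `≤ ρ₀` (its closure stays in the closed unit disc) and the mean-value
inequality on the convex disc of radius `ρ₀` (`norm_sub_le_of_diffContOnCl_near`, constant `G/(1 − ρ₀)` as before).  That is
EXACTLY what the M-test delivers from the termwise data WITHOUT room: terms continuous on the closed disc, differentiable
inside, uniformly majorised ⟹ the sum is continuous on the closed disc and differentiable inside
(`continuousOn_closedBall_of_termwise`, `diffContOnCl_of_termwise`).  §4 types the weaker shapes `OpFibreEnvelopeCl`,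
`HistFibreEnvelopeCl` (implied by file v5's: `opFibreEnvelopeCl_of_opFibreEnvelope`,
`histFibreEnvelopeCl_of_histFibreEnvelope`), proves their legs and `DataLipschitz₂ κ (Gop/(1 − ρ₀)) (Ghist/(1 − ρ₀)) ρ₀`
(`dataLipschitz₂_of_fibreEnvelopesCl`), discharges them from the termwise data under the UNDILATED slack `BoxInClass M K`
(`opFibreEnvelopeCl_of_termwise`, `histFibreEnvelopeCl_of_termwise`), and closes — `ne5_at_of_stepModel_fibreCl₂_scale_nat`,
`ne5_at_of_stepModel_termwise_slack_scale_nat`, `ne5_at_of_stepModel_termwise_slack_budget_scale_nat` (room inequalities `BOp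
+ rOp ≤ ROp`, `BHist + rHist ≤ RHist`, NO factor) — with EXACTLY the smallness `ω + G·c/(1 − ρ₀) < θ′` and the constant of
`T4InputCauchyRateSpecies.ne5_at_of_stepModel_class_scale_nat`: `ClassLineAnalytic` is replaced by the termwise data and
NOTHING else is added.  §5 re-runs the toy with no room (class radii `(1/8, 2)`, class constant `9 ≥ e^{17/8} − 1`, smallness
`1/64 + (27/2)·(1/64) = 29/128 < 1/2`; `toyE_ne5_termwise_slack`).  CENSUS CONSEQUENCE: the factor `r` of (β) is GONE —
W2-hist reads TERMWISE (`TermRep`/`TermBound`/`TermBudget`: the CLASS reading of the expansion (2.13) and of its termwise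
majorants, certified for (2.41) by `READING-W2-CLASS-CERT.md`, NOT PRINTED as statements over a class) ∧ `TermLineAnalytic`
([analysis] PER TERM, not printed) ∧ SLACK (budget + dilation), and the species closure sits at the (g″) table itself.  File
v1's §2 theorems stand unchanged as the closed-disc variant under the stronger room hypothesis.  NE5 NOT PRINTED (G-t4-U3-1).

EXP-LINEAR TERMS (file v1.2, ADDITIVE §6–§7; generation 11).  The technique read LITERALLY on one term — differentiate the
term in the potential under the integral sign: the printed STRUCTURE of the resummed term (2.14) p. 15 is a product of
Cauchy-kernel integrals in `s(Δ)`/`σ(Δ)` and `t(Y)`/`τ(Y)`, two Gaussian integrals in the auxiliary fields and characteristic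
functions, none of which involves the potentials, times the last factor [R] *"exp[Σ_{Y∈𝐃} τ(Y)𝐕_k(Y,B)]"* — the ONLY place the
potentials enter, as the exponential of a combination LINEAR in the potential.  §6 proves the kernel fact for integrands of
that shape, `Φ(a)·exp(Λ(a) y)` with `Φ` integrable, `Λ(a)` continuous linear functionals of the history variable `y`, weakly
measurable and a.e. bounded in operator norm: `y ↦ ∫ Φ(a)·exp(Λ(a) y) dμ(a)` is ENTIRE (`differentiable_integral_mul_cexp_clm`,
by the tree lemma `Literature.Analysis.Complex.differentiableOn_integral_of_dominated` under the local domination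
`‖Φ(a)‖·e^{N(‖y₀‖ + 1)}`), bounded by `(∫‖Φ‖)·e^{N‖y‖}` (`norm_integral_mul_cexp_clm_le`), and along a potential segment
`h + ζv` its derivative is the explicit dominated integral `∫ Φ(a)·exp(Λ(a)(h + ζ₀v))·Λ(a)v dμ`
(`hasDerivAt_integral_mul_cexp_clm_segment`) — no strip and no Cauchy estimate are needed for such a term.  It then SPLITS the
per-term line hypothesis by species (`TermOpLineAnalytic`, `TermHistLineAnalytic`, each implied by `TermLineAnalytic`; the
fibre envelopes need only the matching species: `opFibreEnvelopeCl_of_termwise_op`, `histFibreEnvelopeCl_of_termwise_hist`,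
through the path form `diffContOnCl_of_termwise_path` of the M-test), types the STRUCTURAL shape `TermHistExpLinear K T μ Φ Λ`
(every term is such an integral at every class point, with data depending on the operator point and the domain but NOT on
the history point), PROVES `TermHistExpLinear ⟹ TermHistLineAnalytic` (`termHistLineAnalytic_of_expLinear`), and closes with
the SAME smallness and constant (`ne5_at_of_stepModel_termwise_split_scale_nat`, `…_termwise_expLinear_scale_nat`,
`…_termwise_expLinear_budget_scale_nat`); §7 is the NON-VOID instance (`toyE_ne5_expLinear`: the toy output `exp(o + h) − 1`
as the two-term family `(exp(o)·exp(h), −1)`, each an integral against a Dirac mass of weight × exp ∘ linear; class constant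
`11`, smallness `35/128 < 1/2`).  CENSUS CONSEQUENCE (wall sheet row W2-hist/LINE): the history-species half of
`TermLineAnalytic` — the exponent-critical one — reads STRUCTURE (the class reading of (2.14)'s exp-linear form: this
lineage's DICTIONARY history species ↦ the potential `𝐕_k`, `𝐕_k ↦ 𝐕_k(Y,B)` ↦ evaluation, `(s, σ, t, τ, X, B)` ↦ one measure
space; [analysis], NOT PRINTED as a statement over a class) ∧ DOMINATION (integrable weight, a.e. operator-norm-bounded
exponents — the shape of the printed bounds (2.15) p. 15 / (2.20) p. 16, NOT PRINTED as class statements); the operator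
half stays [analysis] (W2-op, constant-only).  NO number of (g″) moves; NE5 NOT PRINTED (G-t4-U3-1).

## What is PROVED here (kernel-checked, no axioms beyond Lean's, no `sorry`)

§1 (pure complex analysis on discs, index type `ι` arbitrary): `differentiableOn_ball_tsum_of_majorant` (M-test
analyticity of `ζ ↦ Σ' Fᵢ ζ` on an open disc from termwise differentiability and a summable sup-majorant — Mathlib's
theorem, re-exported in the leaf's notation), `norm_tsum_le_of_majorant`, `hasSum_deriv_of_majorant` (the termwise
derivative), `norm_deriv_le_of_ball_bound` (Cauchy's estimate `‖f′(ζ)‖ ≤ G/ρ` for `f` bounded by `G` on the disc of radius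
`R > ‖ζ‖ + ρ`), `norm_deriv_tsum_le_of_majorant` (THE TECHNIQUE: `‖(Σ' Fᵢ)′(ζ)‖ ≤ (Σ' aᵢ)/ρ` on the strip),
`differentiableOn_closedBall_of_strip` (room `r > 1` ⟹ closed unit disc).
§2 (over `M : StepModel C Op Hist`, a class `K`, a term family `T : ℕ → ι → Op → Hist → C.Dom → ℂ` and majorants
`a : ℕ → ι → ℝ`): the shapes `TermRep`, `TermBound`, `TermBudget`, `TermLineAnalytic`; `classBound_of_termwise`;
`differentiableOn_ball_of_termwise`; `opFibreEnvelope_of_termwise`, `histFibreEnvelope_of_termwise` (room `r > 1`);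
`boxInClass_regauge_of_baseBudget` (budget + `r`-room ⟹ the dilated box lies in the ball class);
`ne5_at_of_stepModel_termwise_scale_nat`, `ne5_at_of_stepModel_termwise_budget_scale_nat` (the species closure fed by the
termwise data; smallness `ω + G·c/(1 − ρ₀) < θ′`, constant `(G(δ + δ′)/(1 − ρ₀) + B)(θ′ − ω)/(θ′ − (ω + G·c/(1 − ρ₀)))`
exactly as in `T4InputCauchyRateSpecies.ne5_at_of_stepModel_class_scale_nat`).
§3 (toy): `toyModelE` (file v5's toy data with output `exp(o + h) − 1`), its represented run `toyEAE`/`toyRateE` and the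
binders `toyE_representsA/representsB/inBase/decayA/baseBudget`; the Taylor term family `toyTermE` with majorants `toyMajE`
and `toyE_termRep/termBound/termBudget/termLineAnalytic` on the ball class of radii `(5/32, 9/4)` (class constant `12 ≥
e^{77/32} − 1`); the regauged model `toyModelER = regauge toyModelE (1/8) 1` with its rates; and the end-to-end instance
`toyE_ne5_termwise : NE5 toyEAE toyEB univ 0 (1/2) (…)` through `ne5_at_of_stepModel_termwise_budget_scale_nat` with room
`r = 5/4`, reach `ρ₀ = 1/3` from `k₀ = 5`, `B = 80`, smallness `1/64 + 18·(1/64) = 19/64 < 1/2`.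
§4 (file v1.1; general normed `F` for the two-point bound, then the §2 data): `norm_sub_le_of_diffContOnCl_near`
(`DiffContOnCl` on the unit disc + bound `G` on the closed disc ⟹ `‖f a − f 0‖ ≤ (G/(1 − ρ₀))·a` for `0 ≤ a ≤ ρ₀ < 1`),
`diffContOnCl_ball_of_differentiableOn_closedBall`; the shapes `OpFibreEnvelopeCl`, `HistFibreEnvelopeCl` and
`opFibreEnvelopeCl_of_opFibreEnvelope`, `histFibreEnvelopeCl_of_histFibreEnvelope`; `opLeg_of_opFibreEnvelopeCl`,
`histLeg_of_histFibreEnvelopeCl`, `dataLipschitz₂_of_fibreEnvelopesCl`; `continuousOn_closedBall_of_termwise`,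
`diffContOnCl_of_termwise`; `opFibreEnvelopeCl_of_termwise`, `histFibreEnvelopeCl_of_termwise` (slack `BoxInClass M K`, no
room); `ne5_at_of_stepModel_fibreCl₂_scale_nat`, `ne5_at_of_stepModel_termwise_slack_scale_nat`,
`ne5_at_of_stepModel_termwise_slack_budget_scale_nat`.
§5 (toy, file v1.1): `exp_classRadius₁_sub_one_le` (`e^{17/8} − 1 ≤ 9`), the majorants `toyMajE₁` and
`toyE₁_termRep/termBound/termBudget/termLineAnalytic` on the ball class of radii `(1/8, 2)`, and
`toyE_ne5_termwise_slack : NE5 toyEAE toyEB univ 0 (1/2) (…)` through `ne5_at_of_stepModel_termwise_slack_budget_scale_nat`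
(no room; constant `11656/35`).
§6 (file v1.2; over a complex normed space `Hist`, a measure space `α`, `Φ : α → ℂ`, `Λ : α → (Hist →L[ℂ] ℂ)`):
`norm_mul_cexp_clm_le`, `differentiable_integral_mul_cexp_clm`, `norm_integral_mul_cexp_clm_le`,
`hasDerivAt_integral_mul_cexp_clm_segment`; then over the §2 data: the shapes `TermOpLineAnalytic`, `TermHistLineAnalytic`,
`TermHistExpLinear`; `termOpLineAnalytic_of_termLineAnalytic`, `termHistLineAnalytic_of_termLineAnalytic`;
`diffContOnCl_of_termwise_path`; `opFibreEnvelopeCl_of_termwise_op`, `histFibreEnvelopeCl_of_termwise_hist`;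
`termHistLineAnalytic_of_expLinear`; `ne5_at_of_stepModel_termwise_split_scale_nat`,
`ne5_at_of_stepModel_termwise_expLinear_scale_nat`, `ne5_at_of_stepModel_termwise_expLinear_budget_scale_nat`.
§7 (toy, file v1.2): the two-term family `toyTermD` with majorants `toyMajD = (10, 1)`, Dirac data `toyMeasD`/`toyPhiD`/
`toyLamD`, `toyD_termRep/termBound/termBudget/termOpLineAnalytic/termHistExpLinear` on the ball class of radii `(1/8, 2)`,
and `toyE_ne5_expLinear : NE5 toyEAE toyEB univ 0 (1/2) (…)` through
`ne5_at_of_stepModel_termwise_expLinear_budget_scale_nat` (constant `13144/29`).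

NOT COVERED.  No functional of Bałaban's is constructed, expanded, or shown analytic in anything; no term family, majorant,
class, class constant, margin or room factor is derived for Bałaban's step; the identification of (2.13)/(2.14)/(2.38)/(2.41)
with `TermRep`/`TermLineAnalytic`/`TermBound`/`TermBudget` — and (file v1.2) of (2.14)'s last factor with `TermHistExpLinear` —
is a DICTIONARY ([analysis]), not a construction; no term of Bałaban's is shown to be such an integral; the
activity-level junction is seat P2's (`T4ActivityLipschitz`, `T4ActivityRecursion`) and is not duplicated; the boundary/R-terms
member is seat P3's (`T4BoundaryCarrier`) and is not touched; `T4InputCauchyRateSpecies` (v1.4), `T4InputCauchyRateData`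
(v5), `T4InputCauchyRate` (v1) and `T4OutputRate` are imported BY NAME and not modified.

CITATION HEADER (lean-in-tree rule 2026-08-18).  T. Bałaban, *Renormalization group approach to lattice gauge field
theories. II. Cluster expansions*, Commun. Math. Phys. **116**, 1–22 (1988) [Balaban1988RG2Cluster] (cell paper B13 = [II];
held `paper:balaban1988-cmp116-rg-ii-cluster`, journal page = PDF page); T. Bałaban, *Renormalization group approach to
lattice gauge field theories. I*, Commun. Math. Phys. **109**, 249–301 (1987) [Balaban1987RG1] and *Convergent
renormalization expansions for lattice gauge theories*, Commun. Math. Phys. **119**, 243–285 (1988) [Balaban1988Convergent]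
(named for the framing only).  What is reproduced: NOTHING of the papers' mathematics — only folklore complex analysis, real
bookkeeping and a toy; the [R] strings of this file ([II] p. 5, p. 14, p. 15 ×2, p. 20 ×2 in this docstring, repeated in
the `TermRep`/`TermLineAnalytic` docstrings — the p. 15 last-factor string once more, file v1.2, in the EXP-LINEAR paragraph
above and in `TermHistExpLinear`'s — and p. 20/21 *"Consider a term in the sum … connected domain."* in `TermBound`'s)
are CONTEXT, copied from the lineage loci sheet `t4/b2b-balaban-t4-ne5-p1/b13-loci.md` v1.5 (l.6, l.13, l.14, l.36/58, l.43,
l.63/64) — verbatim strings read on the x2 renders `b2b-balaban-ref1/pages/1988-cmp116-rg-II-cluster/…-pNNN-x2.png` of [II]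
p. 5, 14, 15, 20, 21 by earlier generations of this lineage; NO page was re-read by generations 10–11 and NO quotation is new
to the lineage in this file.  NEW module of unit
`b2b-balaban-t4-ne5-p1` (T⁴ fan-out prover P1 for NE5), generation 10, journal claim T4-U3.E-NE5-PROVE-P1-v10
2026-08-19T15:09:30Z; imports `T4InputCauchyRateSpecies` (file v1.4: `regauge` and its covariance lemmas, `BoxInClass`,
`ClassBound`, `opSegment_mem_box`, `histSegment_mem_box`, `ballClass`, `BaseBudget`, `boxInClass_of_baseBudget`,
`ne5_at_of_stepModel_fibre₂_scale_nat`, the toy lemmas) BY NAME — and through it `T4InputCauchyRateData` (file v5: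
`StepModel`, `OpFibreEnvelope`, `HistFibreEnvelope`, the toy `toyModel`/`toyIns` and its structural lemmas), `T4OutputRate`
(carriers, `NE5`, `DecayBound`) and `T4InputCauchyRate` (`toyCarriers`, `toyEB`) — and modifies nothing.  File v1.1
(generation 10, same claim): ADDITIVE §4–§5 (also BY NAME: `opLeg`/`histLeg`-shaped statements re-proved here, v1.4's
`ne5_at_of_stepModel_lip₂_nat`, `DataLipschitz₂`, v5's `insertionDampedNat_of_affine`, `sizeDampedNat_of_scaleBound`) and
module-docstring amendments; the code of §1–§3 is byte-identical to file v1; no quotation added.  File v1.2 (generation 11,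
journal claim T4-U3.E-NE5-PROVE-P1-v11 2026-08-19T16:01:27Z): ADDITIVE §6–§7, ONE added import
(`Literature.Analysis.Complex.HolomorphicParametricIntegral`, BY NAME: `differentiableOn_integral_of_dominated`; Mathlib's
`hasDerivAt_integral_of_dominated_loc_of_deriv_le`, `integral_dirac` also by name) and module-docstring amendments; the code
of §1–§5 is byte-identical to file v1.1; no quotation new to the lineage (the p. 15 string recurs twice).
-/

noncomputable section

open Metric Set Finset

namespace Literature.MathematicalPhysics.QuantumFieldTheory.Balaban1983to89.T4InputCauchyRateTermwise

open Literature.MathematicalPhysics.QuantumFieldTheory.Balaban1983to89.T4OutputRate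
open Literature.MathematicalPhysics.QuantumFieldTheory.Balaban1983to89.T4InputCauchyRate
open Literature.MathematicalPhysics.QuantumFieldTheory.Balaban1983to89.T4InputCauchyRateData
open Literature.MathematicalPhysics.QuantumFieldTheory.Balaban1983to89.T4InputCauchyRateSpecies

/-! ## §1 The technique in its literal form: termwise differentiation of a majorised expansion on a disc -/

section CauchyStrip

variable {ι : Type*}

/-- **M-TEST ANALYTICITY** (Weierstrass; Mathlib's `Complex.differentiableOn_tsum_of_summable_norm` in the leaf's notation):
a family `Fᵢ` of functions complex differentiable on the open disc of radius `R`, dominated there term by term by a summable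
majorant `aᵢ`, has a complex differentiable sum on that disc. [folklore] -/
theorem differentiableOn_ball_tsum_of_majorant {F : ι → ℂ → ℂ} {a : ι → ℝ} {R : ℝ} (ha : Summable a)
    (hF : ∀ i, DifferentiableOn ℂ (F i) (ball 0 R)) (hle : ∀ i, ∀ w ∈ ball (0 : ℂ) R, ‖F i w‖ ≤ a i) :
    DifferentiableOn ℂ (fun w : ℂ => ∑' i, F i w) (ball 0 R) :=
  Complex.differentiableOn_tsum_of_summable_norm ha hF isOpen_ball hle

/-- **TERMWISE BOUND**: a series dominated term by term by a summable majorant of sum at most `G` has norm at most `G`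
(whether or not it converges — Lean's `∑'` of a non-summable family is `0`). [folklore] -/
theorem norm_tsum_le_of_majorant {f : ι → ℂ} {a : ι → ℝ} {G : ℝ} (ha : Summable a) (hG : ∑' i, a i ≤ G)
    (hle : ∀ i, ‖f i‖ ≤ a i) : ‖∑' i, f i‖ ≤ G :=
  (tsum_of_norm_bounded ha.hasSum hle).trans hG

/-- **TERMWISE DIFFERENTIATION** (Mathlib's `Complex.hasSum_deriv_of_summable_norm`): under the M-test hypotheses the
derivative of the sum is the (convergent) sum of the derivatives at every point of the open disc. [folklore] -/
theorem hasSum_deriv_of_majorant {F : ι → ℂ → ℂ} {a : ι → ℝ} {R : ℝ} (ha : Summable a)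
    (hF : ∀ i, DifferentiableOn ℂ (F i) (ball 0 R)) (hle : ∀ i, ∀ w ∈ ball (0 : ℂ) R, ‖F i w‖ ≤ a i) {ζ : ℂ}
    (hζ : ζ ∈ ball (0 : ℂ) R) : HasSum (fun i => deriv (F i) ζ) (deriv (fun w : ℂ => ∑' i, F i w) ζ) :=
  Complex.hasSum_deriv_of_summable_norm ha hF isOpen_ball hle hζ

/-- **CAUCHY'S ESTIMATE ON THE STRIP**: a function complex differentiable on the open disc of radius `R` and bounded by `G`
there has `‖f′(ζ)‖ ≤ G/ρ` whenever the closed disc of radius `ρ > 0` around `ζ` fits inside (`‖ζ‖ + ρ < R`). [folklore] -/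
theorem norm_deriv_le_of_ball_bound {f : ℂ → ℂ} {R G ρ : ℝ} {ζ : ℂ} (hf : DifferentiableOn ℂ f (ball 0 R))
    (hle : ∀ w ∈ ball (0 : ℂ) R, ‖f w‖ ≤ G) (hρ : 0 < ρ) (hsub : ‖ζ‖ + ρ < R) : ‖deriv f ζ‖ ≤ G / ρ := by
  have hball : closedBall ζ ρ ⊆ ball (0 : ℂ) R := by
    intro w hw
    rw [mem_closedBall, dist_eq_norm] at hw
    rw [mem_ball, dist_zero_right]
    calc ‖w‖ = ‖(w - ζ) + ζ‖ := by rw [sub_add_cancel]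
      _ ≤ ‖w - ζ‖ + ‖ζ‖ := norm_add_le _ _
      _ < R := by linarith
  exact Complex.norm_deriv_le_of_forall_mem_sphere_norm_le hρ (hf.diffContOnCl_ball hball)
    fun w hw => hle w (hball (sphere_subset_closedBall hw))

/-- **THE TECHNIQUE** — "differentiate the convergent expansion term-wise and bound term-wise (analyticity strip ⇒ Cauchy
estimate)": under the M-test hypotheses on the open disc of radius `R`, at every `ζ` with `‖ζ‖ + ρ < R` the derivative of the
sum is bounded by `(Σ' aᵢ)/ρ` — each term's derivative by `aᵢ/ρ` (Cauchy), summed (the termwise derivative converges to the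
derivative of the sum). [folklore] -/
theorem norm_deriv_tsum_le_of_majorant {F : ι → ℂ → ℂ} {a : ι → ℝ} {R ρ : ℝ} (ha : Summable a)
    (hF : ∀ i, DifferentiableOn ℂ (F i) (ball 0 R)) (hle : ∀ i, ∀ w ∈ ball (0 : ℂ) R, ‖F i w‖ ≤ a i) {ζ : ℂ}
    (hρ : 0 < ρ) (hsub : ‖ζ‖ + ρ < R) : ‖deriv (fun w : ℂ => ∑' i, F i w) ζ‖ ≤ (∑' i, a i) / ρ := by
  have hζ : ζ ∈ ball (0 : ℂ) R := by
    rw [mem_ball, dist_zero_right]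
    linarith
  exact (hasSum_deriv_of_majorant ha hF hle hζ).norm_le_of_bounded (ha.hasSum.div_const ρ)
    fun i => norm_deriv_le_of_ball_bound (hF i) (hle i) hρ hsub

/-- **ROOM ⟹ CLOSED UNIT DISC**: complex differentiability on the open disc of radius `r > 1` restricts to the closed unit
disc — the form consumed by the unit-disc Cauchy two-point bound of `T4InputCauchyRateData` (`norm_sub_le_of_unitDisc_near`)
through the fibre envelopes.  [analysis] The room is NEEDED: termwise differentiability within the CLOSED unit disc with a
summable sup-majorant does not give differentiability of the sum within the closed disc (the terms `ζⁿ/n²` are entire, have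
sup `1/n²` on the closed unit disc, and their sum is not differentiable within the closed disc at `ζ = 1`). [folklore] -/
theorem differentiableOn_closedBall_of_strip {f : ℂ → ℂ} {r : ℝ} (hr : 1 < r) (hf : DifferentiableOn ℂ f (ball 0 r)) :
    DifferentiableOn ℂ f (closedBall 0 1) :=
  hf.mono (closedBall_subset_ball hr)

end CauchyStrip

/-! ## §2 The termwise hypothesis shapes over a step model and an input class; class bound, segment analyticity with room,
## the two fibre envelopes, and the species closure fed by termwise data -/

section Termwise

variable {C : Carriers} {Op Hist : Type*} [NormedAddCommGroup Op] [NormedSpace ℂ Op] [NormedAddCommGroup Hist]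
  [NormedSpace ℂ Hist] {ι : Type*} (M : StepModel C Op Hist) (K : ℕ → (ℕ → ℝ) → C.BgB → Set (Op × Hist))
  (T : ℕ → ι → Op → Hist → C.Dom → ℂ)

/-- HYPOTHESIS SHAPE `TermRep K T` (printed SUPPORT, not a printed statement: [II] p. 14 DEFINES the one-step output
`𝐄^{(k+1)}(X)` by the series (2.13) — `Σ_{n≥1}(1/n!)Σ_{(Z₁,…,Zₙ):∪Zᵢ=X} ρᵀ(Z₁,…,Zₙ)H(Z₁)…H(Zₙ)` in the loci sheet's
transcription — and p. 20 [R] *"The above lemma implies that sufficient conditions for convergence of the series (2.12),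
(2.13) are satisfied, see [26, 67, 25, 50]."*; NOT PRINTED as a statement at every point of an input class `K`, which is the
CLASS reading of `T4InputCauchyRateSpecies` §6): at every point `q` of the class, the step-`k` output at a step-`k` domain is
the sum of the CONVERGENT expansion with terms `T k i q.1 q.2 X`, `i : ι` (one index type for all steps and domains: terms
irrelevant to a given `(k, X)` are zero). [folklore] -/
def TermRep (W : Set (ℕ → ℝ)) : Prop :=
  ∀ k, ∀ g ∈ W, ∀ (U : C.BgB) (q : Op × Hist), q ∈ K k g U → ∀ X : C.Dom, C.scale X = k →
    HasSum (fun i => T k i q.1 q.2 X) (M.Out k q.1 q.2 X)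

/-- HYPOTHESIS SHAPE `TermBound K T κ a` (printed SUPPORT: [II] p. 20 [R] *"The series (2.13), defining 𝐄^{(k+1)}(X), is
estimated in the standard way, each factor |H(Z)| is replaced by the right-hand side of (2.38) in the bound."* — Lemma 3
(2.38) p. 20 being the activity bound — and p. 20/21, term by term: [R] *"Consider a term in the sum. We have a product of n
exponentials from (2.38). We"* [p. 21] *"extract the exponential exp(−δ½Lκd_{k+1}(Z_i)) from the i-th factor, and the
remaining product is estimated using (2.27), and the condition ∪Z_i = X, X is a connected domain."*, yielding (2.39)–(2.41):
a TERMWISE majorant = a term weight times the `X`-uniform decay factor; NOT PRINTED as a statement over a class `K`): at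
every class point every term is dominated by its weight `a k i` times `e^{−κd(X)}`. [folklore] -/
def TermBound (W : Set (ℕ → ℝ)) (κ : ℝ) (a : ℕ → ι → ℝ) : Prop :=
  ∀ k, ∀ g ∈ W, ∀ (U : C.BgB) (q : Op × Hist), q ∈ K k g U → ∀ X : C.Dom, C.scale X = k →
    ∀ i, ‖T k i q.1 q.2 X‖ ≤ a k i * Real.exp (-(κ * C.d X))

/-- HYPOTHESIS SHAPE `TermBudget a G` (printed SUPPORT: the summation of the termwise majorants of (2.13) to (2.41) p. 21,
`|𝐄^{(k+1)}(X)| ≤ O(1)C₃ε₁exp(−(1−10δ)½Lκd_{k+1}(X))` in the loci sheet's transcription — the class constant `G` of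
`T4InputCauchyRateSpecies.ClassBound` at the `O(1)C₃ε₁` level): at every step the weights are summable with sum at most `G`.
[folklore] -/
def TermBudget (a : ℕ → ι → ℝ) (G : ℝ) : Prop :=
  ∀ k, Summable (a k) ∧ ∑' i, a k i ≤ G

/-- HYPOTHESIS SHAPE `TermLineAnalytic K T` ([analysis] of the printed STRUCTURE, term by term: in the resummed term (2.14)
p. 15 of [II] the potentials enter ONLY through the last factor [R] *"exp[Σ_{Y∈𝐃} τ(Y)𝐕_k(Y,B)]"* — the exponential of a
`τ`-linear combination — so along a complex segment of potentials the integrand is `exp` of an affine function of the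
segment parameter; the operators enter through the `σ(Δ)`-analytic constructions of p. 5/p. 15; NOT PRINTED for segments in
the potentials or the operators): along every complex segment `ζ ↦ (o + ζu, h + ζv)` whose closed unit part lies in the
class, EVERY TERM of the expansion at a step-`k` domain is complex differentiable on the closed unit disc.  (The termwise —
and, by `differentiableOn_ball_of_termwise`, only open-disc-strong — form of `T4InputCauchyRateSpecies.ClassLineAnalytic`.)
[folklore] -/
def TermLineAnalytic (W : Set (ℕ → ℝ)) : Prop :=
  ∀ k, ∀ g ∈ W, ∀ (U : C.BgB) (o u : Op) (h v : Hist),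
    (∀ ζ ∈ closedBall (0 : ℂ) 1, (o + ζ • u, h + ζ • v) ∈ K k g U) → ∀ X : C.Dom, C.scale X = k →
      ∀ i, DifferentiableOn ℂ (fun ζ : ℂ => T k i (o + ζ • u) (h + ζ • v) X) (closedBall 0 1)

variable {M K T}

/-- **TERMWISE ⟹ CLASS BOUND**: `TermRep ∧ TermBound κ a ∧ TermBudget a G ⟹ ClassBound K κ G` — the norm of a convergent
sum is at most the sum of its termwise majorants ([II] p. 20's *"estimated in the standard way"*, as a kernel statement
about the shapes). [folklore] -/
theorem classBound_of_termwise {W : Set (ℕ → ℝ)} {κ G : ℝ} {a : ℕ → ι → ℝ} (hrep : TermRep M K T W)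
    (hbd : TermBound K T W κ a) (hbud : TermBudget a G) : ClassBound M K W κ G := by
  intro k g hg U q hq X hX
  have h1 : ‖M.Out k q.1 q.2 X‖ ≤ (∑' i, a k i) * Real.exp (-(κ * C.d X)) :=
    (hrep k g hg U q hq X hX).norm_le_of_bounded ((hbud k).1.hasSum.mul_right _) (hbd k g hg U q hq X hX)
  exact h1.trans (mul_le_mul_of_nonneg_right (hbud k).2 (Real.exp_pos _).le)

/-- **TERMWISE ⟹ SEGMENT ANALYTICITY ON THE OPEN DISC** (the M-test along a segment): if the closed unit part of a complex
segment lies in the class, the output along the segment is complex differentiable on the OPEN unit disc — each term is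
differentiable there (`TermLineAnalytic`, restricted), dominated by `a k i · e^{−κd(X)}` (`TermBound` at the segment's
points, which lie in the class), the weights are summable (`TermBudget`), and the sum IS the output (`TermRep`).  Open disc
only: see `differentiableOn_closedBall_of_strip`. [folklore] -/
theorem differentiableOn_ball_of_termwise {W : Set (ℕ → ℝ)} {κ G : ℝ} {a : ℕ → ι → ℝ} (hrep : TermRep M K T W)
    (hbd : TermBound K T W κ a) (hbud : TermBudget a G) (hline : TermLineAnalytic K T W) {k : ℕ} {g : ℕ → ℝ}
    (hg : g ∈ W) {U : C.BgB} {o u : Op} {h v : Hist}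
    (hseg : ∀ ζ ∈ closedBall (0 : ℂ) 1, (o + ζ • u, h + ζ • v) ∈ K k g U) {X : C.Dom} (hX : C.scale X = k) :
    DifferentiableOn ℂ (fun ζ : ℂ => M.Out k (o + ζ • u) (h + ζ • v) X) (ball 0 1) := by
  have hF : ∀ i, DifferentiableOn ℂ (fun ζ : ℂ => T k i (o + ζ • u) (h + ζ • v) X) (ball 0 1) :=
    fun i => (hline k g hg U o u h v hseg X hX i).mono ball_subset_closedBall
  have hle : ∀ i, ∀ ζ ∈ ball (0 : ℂ) 1, ‖T k i (o + ζ • u) (h + ζ • v) X‖ ≤ a k i * Real.exp (-(κ * C.d X)) :=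
    fun i ζ hζ => hbd k g hg U _ (hseg ζ (ball_subset_closedBall hζ)) X hX i
  have hsum := Complex.differentiableOn_tsum_of_summable_norm ((hbud k).1.mul_right _) hF isOpen_ball hle
  exact hsum.congr fun ζ hζ => ((hrep k g hg U _ (hseg ζ (ball_subset_closedBall hζ)) X hX).tsum_eq).symm

/-- The `1/r`-contraction of the closed unit disc lies in the open unit disc (`r > 1`): the room. [folklore] -/
theorem mapsTo_mul_inv_closedBall_ball {r : ℝ} (hr0 : 0 < r) (hr : 1 < r) :
    MapsTo (fun ζ : ℂ => ζ * ((r : ℂ))⁻¹) (closedBall 0 1) (ball 0 1) := by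
  intro ζ hζ
  rw [mem_closedBall, dist_zero_right] at hζ
  rw [mem_ball, dist_zero_right, norm_mul, norm_inv, Complex.norm_real, Real.norm_of_nonneg hr0.le]
  calc ‖ζ‖ * r⁻¹ ≤ 1 * r⁻¹ := mul_le_mul_of_nonneg_right hζ (inv_pos.2 hr0).le
    _ < 1 := by rw [one_mul]; exact inv_lt_one_of_one_lt₀ hr

/-- **TERMWISE + ROOM ⟹ OPERATOR FIBRE ENVELOPE.**  If the `r`-DILATED two-margin box around every base point lies in the
class (`BoxInClass (regauge M r r) K`, `r > 1`) and the termwise data hold on the class, then `M` — with its OWN margins —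
satisfies `OpFibreEnvelope κ G`: for an operator direction `u` within the margin, the dilated direction `r•u` has its closed
unit segment in the dilated box, hence in the class, so the output along it is differentiable on the open unit disc
(`differentiableOn_ball_of_termwise`), and `ζ ↦ Out(p.1 + ζu)` is that function at `ζ/r`, `|ζ/r| ≤ 1/r < 1`; the envelope
on the closed unit segment of `u` is the class bound (`classBound_of_termwise`). [folklore] -/
theorem opFibreEnvelope_of_termwise {W : Set (ℕ → ℝ)} {κ G : ℝ} {a : ℕ → ι → ℝ} {r : ℝ} (hr0 : 0 < r) (hr : 1 < r)
    (hbox : BoxInClass (regauge M r r hr0 hr0) K W) (hrep : TermRep M K T W) (hbd : TermBound K T W κ a)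
    (hbud : TermBudget a G) (hline : TermLineAnalytic K T W) : M.OpFibreEnvelope W κ G := by
  have hcb : ClassBound M K W κ G := classBound_of_termwise hrep hbd hbud
  have hrC : (r : ℂ) ≠ 0 := Complex.ofReal_ne_zero.2 hr0.ne'
  intro k g hg U p hp X hX h hh u hu
  have hrOp : M.rOp k ≤ (regauge M r r hr0 hr0).rOp k := le_mul_of_one_le_left (M.rOp_pos k).le hr.le
  have hh' : h ∈ closedBall p.2 ((regauge M r r hr0 hr0).rHist k) :=
    closedBall_subset_closedBall (le_mul_of_one_le_left (M.rHist_pos k).le hr.le) hh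
  have hu' : ‖(r : ℂ) • u‖ ≤ (regauge M r r hr0 hr0).rOp k := by
    rw [norm_smul, Complex.norm_real, Real.norm_of_nonneg hr0.le]
    exact mul_le_mul_of_nonneg_left hu hr0.le
  refine ⟨?_, fun ζ hζ => hcb k g hg U _ (hbox k g hg U p hp (opSegment_mem_box hh' (hu.trans hrOp) hζ)) X hX⟩
  have hseg : ∀ ζ ∈ closedBall (0 : ℂ) 1, (p.1 + ζ • ((r : ℂ) • u), h + ζ • (0 : Hist)) ∈ K k g U :=
    fun ζ hζ => by simpa only [smul_zero, add_zero] using hbox k g hg U p hp (opSegment_mem_box hh' hu' hζ)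
  have hf : DifferentiableOn ℂ (fun w : ℂ => M.Out k (p.1 + w • ((r : ℂ) • u)) h X) (ball 0 1) := by
    simpa only [smul_zero, add_zero] using differentiableOn_ball_of_termwise hrep hbd hbud hline hg hseg hX
  have hcomp := hf.comp (differentiableOn_id.mul_const ((r : ℂ))⁻¹) (mapsTo_mul_inv_closedBall_ball hr0 hr)
  refine hcomp.congr fun ζ _ => ?_
  simp only [Function.comp_def, smul_smul, inv_mul_cancel_right₀ hrC]

/-- **TERMWISE + ROOM ⟹ HISTORY FIBRE ENVELOPE**, symmetrically (the exponent-critical wall W2-hist of the cell census).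
[folklore] -/
theorem histFibreEnvelope_of_termwise {W : Set (ℕ → ℝ)} {κ G : ℝ} {a : ℕ → ι → ℝ} {r : ℝ} (hr0 : 0 < r) (hr : 1 < r)
    (hbox : BoxInClass (regauge M r r hr0 hr0) K W) (hrep : TermRep M K T W) (hbd : TermBound K T W κ a)
    (hbud : TermBudget a G) (hline : TermLineAnalytic K T W) : M.HistFibreEnvelope W κ G := by
  have hcb : ClassBound M K W κ G := classBound_of_termwise hrep hbd hbud
  have hrC : (r : ℂ) ≠ 0 := Complex.ofReal_ne_zero.2 hr0.ne'
  intro k g hg U p hp X hX o ho v hv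
  have hrHist : M.rHist k ≤ (regauge M r r hr0 hr0).rHist k := le_mul_of_one_le_left (M.rHist_pos k).le hr.le
  have ho' : o ∈ closedBall p.1 ((regauge M r r hr0 hr0).rOp k) :=
    closedBall_subset_closedBall (le_mul_of_one_le_left (M.rOp_pos k).le hr.le) ho
  have hv' : ‖(r : ℂ) • v‖ ≤ (regauge M r r hr0 hr0).rHist k := by
    rw [norm_smul, Complex.norm_real, Real.norm_of_nonneg hr0.le]
    exact mul_le_mul_of_nonneg_left hv hr0.le
  refine ⟨?_, fun ζ hζ => hcb k g hg U _ (hbox k g hg U p hp (histSegment_mem_box ho' (hv.trans hrHist) hζ)) X hX⟩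
  have hseg : ∀ ζ ∈ closedBall (0 : ℂ) 1, (o + ζ • (0 : Op), p.2 + ζ • ((r : ℂ) • v)) ∈ K k g U :=
    fun ζ hζ => by simpa only [smul_zero, add_zero] using hbox k g hg U p hp (histSegment_mem_box ho' hv' hζ)
  have hf : DifferentiableOn ℂ (fun w : ℂ => M.Out k o (p.2 + w • ((r : ℂ) • v)) X) (ball 0 1) := by
    simpa only [smul_zero, add_zero] using differentiableOn_ball_of_termwise hrep hbd hbud hline hg hseg hX
  have hcomp := hf.comp (differentiableOn_id.mul_const ((r : ℂ))⁻¹) (mapsTo_mul_inv_closedBall_ball hr0 hr)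
  refine hcomp.congr fun ζ _ => ?_
  simp only [Function.comp_def, smul_smul, inv_mul_cancel_right₀ hrC]

variable (M K T) in
/-- **NE5 FROM TERMWISE DATA, natural gain, printed age normalisation** — `T4InputCauchyRateSpecies.ne5_at_of_stepModel_
fibre₂_scale_nat` with BOTH fibre envelopes discharged by the termwise data (`Gop = Ghist = G`): representation of the two
runs, admissibility of run B's data, room `r > 1` (`BoxInClass (regauge M r r) K`), `TermRep`, `TermBound κ a`,
`TermBudget a G`, `TermLineAnalytic`, the one-run decay bounds, `OperatorRate δ θ`, `InsertionRate κ E₀ δ′ θ`, the structural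
insertion shapes + the single-scale bound `InsScaleBound κ E₁ c ω`, the near hypothesis and the first scales; smallness
`ω + G·c/(1 − ρ₀) < θ′`; constant `(G(δ + δ′)/(1 − ρ₀) + B)(θ′ − ω)/(θ′ − (ω + G·c/(1 − ρ₀)))` (written species-wise).
The room factor `r` does not appear in the conclusion: it is paid where the class is sized against the margins
(`ne5_at_of_stepModel_termwise_budget_scale_nat`). [folklore] -/
theorem ne5_at_of_stepModel_termwise_scale_nat {EA : Functional C C.BgA} {EB : Functional C C.BgB} {W : Set (ℕ → ℝ)}
    {a : ℕ → ι → ℝ} {r κ G EA₀ E₀ E₁ δ δ' θ θ' c ω ρ₀ B : ℝ} {k₀ : ℕ} (hrA : M.RepresentsA EA W)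
    (hrB : M.RepresentsB EB W) (hbase : M.InBase EB W) (hr0 : 0 < r) (hr : 1 < r)
    (hbox : BoxInClass (regauge M r r hr0 hr0) K W) (hrep : TermRep M K T W) (hbd : TermBound K T W κ a)
    (hbud : TermBudget a G) (hline : TermLineAnalytic K T W)
    (hdA : DecayBound EA W EA₀ κ) (hdB : DecayBound EB W E₀ κ) (hop : M.OperatorRate W δ θ)
    (hins : M.InsertionRate W κ E₀ δ' θ) (haff : M.InsAffine W) (hblind : M.InsBlind W) (hhom : M.InsHomog W)
    (hunit : M.InsScaleBound W κ E₁ c ω) (hE₁ : 0 < E₁) (hG : 0 ≤ G) (hδ : 0 ≤ δ) (hδ' : 0 ≤ δ') (hθ : 0 ≤ θ)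
    (hθθ' : θ ≤ θ') (hθ'1 : θ' ≤ 1) (hc : 0 ≤ c) (hω : 0 < ω) (hρ₀ : ρ₀ < 1)
    (hnear : (δ + δ') * θ ^ k₀ + c * (EA₀ + E₀) / (1 - ω) ≤ ρ₀) (hB : 0 ≤ B) (hfirst : ∀ k < k₀, EA₀ + E₀ ≤ B * θ ^ k)
    (hsmall : ω + G / (1 - ρ₀) * c < θ') :
    NE5 EA EB W κ θ' ((G / (1 - ρ₀) * δ + G / (1 - ρ₀) * δ' + B) * (θ' - ω) / (θ' - (ω + G / (1 - ρ₀) * c))) :=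
  ne5_at_of_stepModel_fibre₂_scale_nat M hrA hrB hbase (opFibreEnvelope_of_termwise hr0 hr hbox hrep hbd hbud hline)
    (histFibreEnvelope_of_termwise hr0 hr hbox hrep hbd hbud hline) hdA hdB hop hins haff hblind hhom hunit hE₁ hG hG hδ
    hδ' hθ hθθ' hθ'1 hc hω hρ₀ hnear hB hfirst hsmall

/-- **BUDGET + r-ROOM ⟹ THE DILATED BOX LIES IN THE BALL CLASS**: `BaseBudget ctr BOp BHist` with the room inequalities
`BOp + r·rOp ≤ ROp`, `BHist + r·rHist ≤ RHist` gives `BoxInClass (regauge M r r) (ballClass ctr ROp RHist)`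
(`T4InputCauchyRateSpecies.boxInClass_of_baseBudget` for the regauged model, whose budget is `M`'s —
`regauge_baseBudget`).  In the dilation currency of `T4InputCauchyRateSpecies` NUMBERS (g″): `rHist = (λ − μ)E₀/r`.
[folklore] -/
theorem boxInClass_regauge_of_baseBudget {W : Set (ℕ → ℝ)} {ctr : ℕ → (ℕ → ℝ) → C.BgB → Op × Hist}
    {BOp BHist ROp RHist : ℕ → ℝ} {r : ℝ} (hr0 : 0 < r) (h : BaseBudget M W ctr BOp BHist)
    (hOp : ∀ k, BOp k + r * M.rOp k ≤ ROp k) (hHist : ∀ k, BHist k + r * M.rHist k ≤ RHist k) :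
    BoxInClass (regauge M r r hr0 hr0) (ballClass ctr ROp RHist) W :=
  boxInClass_of_baseBudget ((regauge_baseBudget M hr0 hr0).2 h) hOp hHist

variable (M T) in
/-- **NE5 FROM BUDGET, r-ROOM AND TERMWISE DATA ON THE ROOMY BALL CLASS** — `ne5_at_of_stepModel_termwise_scale_nat` on the
ball class of radii `ROp ≥ BOp + r·rOp`, `RHist ≥ BHist + r·rHist` with its (dilated) slack discharged by `BaseBudget`:
representation of the two runs, admissibility of run B's data, `BaseBudget ctr BOp BHist`, the two room inequalities with
the factor `r > 1`, the termwise data on `ballClass ctr ROp RHist` with class constant `G`, the one-run decay bounds, the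
rates, the structural insertion shapes + `InsScaleBound`, near hypothesis, first scales; smallness `ω + G·c/(1 − ρ₀) < θ′`.
[folklore] -/
theorem ne5_at_of_stepModel_termwise_budget_scale_nat {EA : Functional C C.BgA} {EB : Functional C C.BgB}
    {W : Set (ℕ → ℝ)} {ctr : ℕ → (ℕ → ℝ) → C.BgB → Op × Hist} {BOp BHist ROp RHist : ℕ → ℝ} {a : ℕ → ι → ℝ}
    {r κ G EA₀ E₀ E₁ δ δ' θ θ' c ω ρ₀ B : ℝ} {k₀ : ℕ} (hrA : M.RepresentsA EA W) (hrB : M.RepresentsB EB W)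
    (hbase : M.InBase EB W) (hbudget : BaseBudget M W ctr BOp BHist) (hr0 : 0 < r) (hr : 1 < r)
    (hOp : ∀ k, BOp k + r * M.rOp k ≤ ROp k) (hHist : ∀ k, BHist k + r * M.rHist k ≤ RHist k)
    (hrep : TermRep M (ballClass ctr ROp RHist) T W) (hbd : TermBound (ballClass ctr ROp RHist) T W κ a)
    (hbud : TermBudget a G) (hline : TermLineAnalytic (ballClass ctr ROp RHist) T W)
    (hdA : DecayBound EA W EA₀ κ) (hdB : DecayBound EB W E₀ κ) (hop : M.OperatorRate W δ θ)
    (hins : M.InsertionRate W κ E₀ δ' θ) (haff : M.InsAffine W) (hblind : M.InsBlind W) (hhom : M.InsHomog W)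
    (hunit : M.InsScaleBound W κ E₁ c ω) (hE₁ : 0 < E₁) (hG : 0 ≤ G) (hδ : 0 ≤ δ) (hδ' : 0 ≤ δ') (hθ : 0 ≤ θ)
    (hθθ' : θ ≤ θ') (hθ'1 : θ' ≤ 1) (hc : 0 ≤ c) (hω : 0 < ω) (hρ₀ : ρ₀ < 1)
    (hnear : (δ + δ') * θ ^ k₀ + c * (EA₀ + E₀) / (1 - ω) ≤ ρ₀) (hB : 0 ≤ B) (hfirst : ∀ k < k₀, EA₀ + E₀ ≤ B * θ ^ k)
    (hsmall : ω + G / (1 - ρ₀) * c < θ') :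
    NE5 EA EB W κ θ' ((G / (1 - ρ₀) * δ + G / (1 - ρ₀) * δ' + B) * (θ' - ω) / (θ' - (ω + G / (1 - ρ₀) * c))) :=
  ne5_at_of_stepModel_termwise_scale_nat M (ballClass ctr ROp RHist) T hrA hrB hbase hr0 hr
    (boxInClass_regauge_of_baseBudget hr0 hbudget hOp hHist) hrep hbd hbud hline hdA hdB hop hins haff hblind hhom hunit
    hE₁ hG hδ hδ' hθ hθθ' hθ'1 hc hω hρ₀ hnear hB hfirst hsmall

end Termwise

/-! ## §3 Non-vacuity: a represented toy whose output is a genuine power series, on which the termwise closure fires -/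

section ToyTermwise

/-- The Taylor expansion of `exp z − 1`: `Σ_{i≥0} z^{i+1}/(i+1)! = e^z − 1` (complex). [folklore] -/
theorem hasSum_expSeries_sub_one (z : ℂ) :
    HasSum (fun i : ℕ => z ^ (i + 1) / ((i + 1).factorial : ℂ)) (Complex.exp z - 1) := by
  have h : HasSum (fun n : ℕ => z ^ n / (n.factorial : ℂ)) (Complex.exp z) := by
    rw [Complex.exp_eq_exp_ℂ]
    exact NormedSpace.expSeries_div_hasSum_exp z
  simpa using (hasSum_nat_add_iff' 1).mpr h

/-- The same expansion over the reals (the majorant series). [folklore] -/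
theorem hasSum_expSeries_sub_one_real (x : ℝ) :
    HasSum (fun i : ℕ => x ^ (i + 1) / ((i + 1).factorial : ℝ)) (Real.exp x - 1) := by
  have h : HasSum (fun n : ℕ => x ^ n / (n.factorial : ℝ)) (Real.exp x) := by
    rw [Real.exp_eq_exp_ℝ]
    exact NormedSpace.expSeries_div_hasSum_exp x
  simpa using (hasSum_nat_add_iff' 1).mpr h

/-- `e^{77/32} − 1 ≤ 12` (`e^{77/32} ≤ e^{5/2} = (e^{1/2})⁵ ≤ (33/20)⁵ < 12.3`, from `e < 2.7182818286 ≤ (33/20)²`).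
[folklore] -/
theorem exp_classRadius_sub_one_le : Real.exp (77 / 32) - 1 ≤ 12 := by
  have h1 : Real.exp (77 / 32) ≤ Real.exp (5 / 2) := Real.exp_le_exp.2 (by norm_num)
  have h2 : Real.exp (5 / 2) = Real.exp (1 / 2) ^ 5 := by
    rw [← Real.exp_nat_mul]; norm_num
  have h3 : Real.exp (1 / 2) ≤ 33 / 20 := by
    by_contra h
    rw [not_le] at h
    have h4 : (33 / 20 : ℝ) ^ 2 < Real.exp (1 / 2) ^ 2 := by gcongr
    rw [← Real.exp_nat_mul] at h4
    norm_num at h4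
    have := Real.exp_one_lt_d9
    linarith
  have h5 : Real.exp (1 / 2) ^ 5 ≤ (33 / 20 : ℝ) ^ 5 := by gcongr
  norm_num at h5
  linarith

/-- Toy run A of the termwise toy: `E_A(0) = e − 1`, `E_A(k + 1) = exp((1/2)^{k+1} + E_A(k)/64) − 1` — the represented
recursion of the output `exp(o + h) − 1` with operator artifact `(1/2)^k` and file v5's history feed (gain `1/64`).
[folklore] -/
def toyRateE : ℕ → ℝ
  | 0 => Real.exp 1 - 1
  | n + 1 => Real.exp ((1 / 2 : ℝ) ^ (n + 1) + 1 / 64 * toyRateE n) - 1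

/-- The toy recursion in closed form. [folklore] -/
theorem toyRateE_step (n : ℕ) :
    toyRateE n = Real.exp ((1 / 2 : ℝ) ^ n + (if n = 0 then 0 else 1 / 64 * toyRateE (n - 1))) - 1 := by
  cases n with
  | zero => simp [toyRateE]
  | succ m => simp [toyRateE]

/-- The toy outputs lie in `[0, 2]` (`e − 1 < 1.72`; then `exp(x) − 1` for `0 ≤ x ≤ 1/2 + 1/32`). [folklore] -/
theorem toyRateE_mem (n : ℕ) : 0 ≤ toyRateE n ∧ toyRateE n ≤ 2 := by
  induction n with
  | zero =>
    have h1 := Real.exp_one_lt_d9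
    have h2 := Real.add_one_le_exp (1 : ℝ)
    simp only [toyRateE]
    constructor <;> linarith
  | succ m ih =>
    simp only [toyRateE]
    have hx0 : 0 ≤ (1 / 2 : ℝ) ^ (m + 1) + 1 / 64 * toyRateE m :=
      add_nonneg (pow_nonneg (by norm_num) _) (mul_nonneg (by norm_num) ih.1)
    have hx1 : (1 / 2 : ℝ) ^ (m + 1) + 1 / 64 * toyRateE m ≤ 1 := by
      have : (1 / 2 : ℝ) ^ (m + 1) ≤ 1 / 2 := by
        rw [pow_succ]
        have := pow_le_one₀ (by norm_num : (0 : ℝ) ≤ 1 / 2) (by norm_num : (1 / 2 : ℝ) ≤ 1) (n := m)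
        nlinarith
      linarith [ih.2]
    have h3 := Real.add_one_le_exp ((1 / 2 : ℝ) ^ (m + 1) + 1 / 64 * toyRateE m)
    have h4 : Real.exp ((1 / 2 : ℝ) ^ (m + 1) + 1 / 64 * toyRateE m) ≤ Real.exp 1 := Real.exp_le_exp.2 hx1
    have h5 := Real.exp_one_lt_d9
    constructor <;> linarith

/-- Toy run A as a functional on v1's toy carriers. [folklore] -/
def toyEAE : Functional toyCarriers toyCarriers.BgA := fun _ _ X => toyRateE (toyCarriers.scale X)

/-- The termwise toy model: file v5's `toyModel` (operator data `(1/2)^k` versus `0`, the same insertion "read the previous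
scale with gain 1/64" for both runs, base class `{o = 0, ‖h‖ ≤ 1}`, unit margins) with the output map replaced by the
ENTIRE, genuinely non-polynomial `Out(o, h) = exp(o + h) − 1`. [folklore] -/
def toyModelE : StepModel toyCarriers ℂ ℂ :=
  { toyModel with Out := fun _ o h _ => Complex.exp (o + h) - 1 }

/-- Real part of `exp(x) − 1` at a real argument. [folklore] -/
theorem re_exp_ofReal_sub_one (x : ℝ) : (Complex.exp (x : ℂ) - 1).re = Real.exp x - 1 := by
  rw [Complex.sub_re, Complex.one_re, ← Complex.ofReal_exp, Complex.ofReal_re]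

/-- Toy: run B (≡ 0) is represented (`exp(0 + 0) − 1 = 0`). [folklore] -/
theorem toyE_representsB : toyModelE.RepresentsB toyEB Set.univ := by
  intro g _ U X
  simp [toyModelE, toyModel, toyIns, toyEB, tableB]

/-- Toy: run A is represented — the defining recursion of `toyRateE`. [folklore] -/
theorem toyE_representsA : toyModelE.RepresentsA toyEAE Set.univ := by
  intro g _ U X
  show toyRateE (toyCarriers.scale X) =
    (Complex.exp ((((1 / 2 : ℝ) ^ toyCarriers.scale X : ℝ) : ℂ) +
      (if toyCarriers.scale X = 0 then (0 : ℂ)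
        else ((1 / 64 * toyRateE (toyCarriers.scale X - 1) : ℝ) : ℂ))) - 1).re
  generalize toyCarriers.scale X = n
  have hre : ((((1 / 2 : ℝ) ^ n : ℝ) : ℂ) +
      (if n = 0 then (0 : ℂ) else ((1 / 64 * toyRateE (n - 1) : ℝ) : ℂ))) =
        (((1 / 2 : ℝ) ^ n + (if n = 0 then 0 else 1 / 64 * toyRateE (n - 1)) : ℝ) : ℂ) := by
    split_ifs <;> push_cast <;> ring
  rw [hre, re_exp_ofReal_sub_one, toyRateE_step n]

/-- Toy: run B's data `(0, 0)` lie in the base class. [folklore] -/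
theorem toyE_inBase : toyModelE.InBase toyEB Set.univ := by
  intro k g _ U
  simp [toyModelE, toyModel, StepModel.dataB, toyIns, tableB, toyEB]

/-- Toy: one-run bound of run A with constant `2`. [folklore] -/
theorem toyE_decayA : DecayBound toyEAE Set.univ 2 0 := by
  intro g _ U X
  simp only [toyEAE, zero_mul, neg_zero, Real.exp_zero, mul_one]
  obtain ⟨h0, h2⟩ := toyRateE_mem (toyCarriers.scale X)
  rw [abs_of_nonneg h0]
  exact h2

/-- Toy: the base class has budgets `(0, 1)` around the origin (worst printed case `μ = 1`). [folklore] -/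
theorem toyE_baseBudget : BaseBudget toyModelE Set.univ toyCtr (fun _ => 0) fun _ => 1 := by
  intro k g _ U p hp
  obtain ⟨hp1, hp2⟩ : p.1 = 0 ∧ ‖p.2‖ ≤ 1 := hp
  refine ⟨?_, ?_⟩
  · show ‖p.1 - 0‖ ≤ 0
    rw [hp1, sub_zero, norm_zero]
  · show ‖p.2 - 0‖ ≤ 1
    rwa [sub_zero]

/-- Toy: the operator rate at unit margins is file v5's (`δ = 1`, `θ = 1/2`). [folklore] -/
theorem toyE_operatorRate : toyModelE.OperatorRate Set.univ 1 (1 / 2) := toy_operatorRate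

/-- Toy: the two runs insert identically (`δ′ = 0`). [folklore] -/
theorem toyE_insertionRate : toyModelE.InsertionRate Set.univ 0 3 0 (1 / 2) := toy_insertionRate

/-- Toy: the single-scale insertion bound at level `3` with gain `1/64` is file v5's. [folklore] -/
theorem toyE_insScaleBound {ω : ℝ} (hω : 0 ≤ ω) : toyModelE.InsScaleBound Set.univ 0 3 (1 / 64) ω := toy_insScaleBound hω

/-- The termwise toy read with operator margin `1/8` (history margin `1`): `toyModelER`.  In this gauge `δ = 8`, `δ′ = 0`,
`c = 1/64`, and the `r`-dilated box around a base point `(0, h)`, `‖h‖ ≤ 1`, is `{‖o‖ ≤ r/8} × {‖h′ − h‖ ≤ r}`. [folklore] -/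
def toyModelER : StepModel toyCarriers ℂ ℂ := regauge toyModelE (1 / 8) 1 (by norm_num) one_pos

/-- Toy, regauged: operator rate `δ = 1/(1/8) = 8` at `θ = 1/2`. [folklore] -/
theorem toyER_operatorRate : toyModelER.OperatorRate Set.univ 8 (1 / 2) := by
  have h := operatorRate_regauge toyModelE (by norm_num : (0 : ℝ) < 1 / 8) one_pos toyE_operatorRate
  rw [show (1 : ℝ) / (1 / 8) = 8 by norm_num] at h
  exact h

/-- Toy, regauged: `δ′ = 0/1 = 0`. [folklore] -/
theorem toyER_insertionRate : toyModelER.InsertionRate Set.univ 0 3 0 (1 / 2) := by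
  have h := insertionRate_regauge toyModelE (by norm_num : (0 : ℝ) < 1 / 8) one_pos toyE_insertionRate
  rw [zero_div] at h
  exact h

/-- Toy, regauged: single-scale insertion gain `(1/64)/1 = 1/64` at level `3`. [folklore] -/
theorem toyER_insScaleBound {ω : ℝ} (hω : 0 ≤ ω) : toyModelER.InsScaleBound Set.univ 0 3 (1 / 64) ω := by
  have h := insScaleBound_regauge toyModelE (by norm_num : (0 : ℝ) < 1 / 8) one_pos (toyE_insScaleBound hω)
  rw [div_one] at h
  exact h

/-- The toy's TERM FAMILY: the Taylor terms `(o + h)^{i+1}/(i+1)!` of `exp(o + h) − 1` (index type `ℕ`, the same at every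
step and domain). [folklore] -/
def toyTermE : ℕ → ℕ → ℂ → ℂ → toyCarriers.Dom → ℂ := fun _ i o h _ => (o + h) ^ (i + 1) / ((i + 1).factorial : ℂ)

/-- The toy's MAJORANTS on the ball class of radii `(5/32, 9/4)`: `(77/32)^{i+1}/(i+1)!`. [folklore] -/
def toyMajE : ℕ → ℕ → ℝ := fun _ i => (77 / 32 : ℝ) ^ (i + 1) / ((i + 1).factorial : ℝ)

/-- Toy: `TermRep` — the output IS its Taylor series, at every point (in particular on the class). [folklore] -/
theorem toyE_termRep : TermRep toyModelER (ballClass toyCtr (fun _ => 5 / 32) fun _ => 9 / 4) toyTermE Set.univ := by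
  intro k g _ U q _ X _
  exact hasSum_expSeries_sub_one (q.1 + q.2)

/-- Toy: `TermBound` — on the ball class `‖o + h‖ ≤ 5/32 + 9/4 = 77/32`, so `‖(o + h)^{i+1}/(i+1)!‖ ≤ (77/32)^{i+1}/(i+1)!`.
[folklore] -/
theorem toyE_termBound : TermBound (ballClass toyCtr (fun _ => 5 / 32) fun _ => 9 / 4) toyTermE Set.univ 0 toyMajE := by
  intro k g _ U q hq X _ i
  obtain ⟨hq1, hq2⟩ := Set.mem_prod.1 hq
  rw [mem_closedBall, dist_eq_norm] at hq1 hq2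
  have h1 : ‖q.1‖ ≤ 5 / 32 := by simpa [toyCtr] using hq1
  have h2 : ‖q.2‖ ≤ 9 / 4 := by simpa [toyCtr] using hq2
  have hR : ‖q.1 + q.2‖ ≤ 77 / 32 := (norm_add_le _ _).trans (by linarith)
  show ‖(q.1 + q.2) ^ (i + 1) / ((i + 1).factorial : ℂ)‖ ≤
    (77 / 32 : ℝ) ^ (i + 1) / ((i + 1).factorial : ℝ) * Real.exp (-(0 * toyCarriers.d X))
  rw [zero_mul, neg_zero, Real.exp_zero, mul_one, norm_div, norm_pow, Complex.norm_natCast]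
  exact div_le_div_of_nonneg_right (pow_le_pow_left₀ (norm_nonneg _) hR _) (Nat.cast_nonneg _)

/-- Toy: `TermBudget` with class constant `12` — the majorants sum to `e^{77/32} − 1 ≤ 12`. [folklore] -/
theorem toyE_termBudget : TermBudget toyMajE 12 := by
  intro k
  have h := hasSum_expSeries_sub_one_real (77 / 32)
  refine ⟨h.summable, ?_⟩
  show ∑' i, (77 / 32 : ℝ) ^ (i + 1) / ((i + 1).factorial : ℝ) ≤ 12
  rw [h.tsum_eq]
  exact exp_classRadius_sub_one_le

/-- Toy: `TermLineAnalytic` — every Taylor term is a polynomial in the segment parameter, entire. [folklore] -/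
theorem toyE_termLineAnalytic :
    TermLineAnalytic (ballClass toyCtr (fun _ => 5 / 32) fun _ => 9 / 4) toyTermE Set.univ := by
  intro k g _ U o u h v _ X _ i
  show DifferentiableOn ℂ (fun ζ : ℂ => ((o + ζ • u) + (h + ζ • v)) ^ (i + 1) / ((i + 1).factorial : ℂ))
    (closedBall 0 1)
  apply Differentiable.differentiableOn
  simp only [smul_eq_mul]
  fun_prop

/-- **THE TERMWISE CLOSURE FIRES ON THE TOY** (vacuity witness for `ne5_at_of_stepModel_termwise_budget_scale_nat`):
budgets `(0, 1)` (`toyE_baseBudget`), margins `(1/8, 1)`, room `r = 5/4` into the ball class of radii `(5/32, 9/4)`,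
termwise data = the Taylor expansion of `exp(o + h) − 1` with factorial majorants and class constant `G = 12`; rates `δ = 8`,
`δ′ = 0`, `θ = θ′ = 1/2`; structure binders of file v5's toy; single-scale gain `c = 1/64` at `ω = 1/64`, level `E₁ = 3`;
decay levels `2 + 3`; reach `ρ₀ = 1/3` from the first scale `k₀ = 5` (`8·(1/2)^5 + (1/64)·5/(1 − 1/64) = 83/252 ≤ 1/3`),
start-up constant `B = 80 = 5·2^4`; smallness `1/64 + (12/(1 − 1/3))·(1/64) = 19/64 < 1/2`.  Every binder is met by a
non-degenerate model whose output is an honest infinite series, and the conclusion is a genuine `NE5` rate `1/2`. [folklore]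
-/
theorem toyE_ne5_termwise : NE5 toyEAE toyEB (Set.univ : Set (ℕ → ℝ)) 0 (1 / 2)
    ((12 / (1 - 1 / 3) * 8 + 12 / (1 - 1 / 3) * 0 + 80) * (1 / 2 - 1 / 64) /
      (1 / 2 - (1 / 64 + 12 / (1 - 1 / 3) * (1 / 64)))) :=
  ne5_at_of_stepModel_termwise_budget_scale_nat toyModelER toyTermE (ctr := toyCtr) (BOp := fun _ => 0)
    (BHist := fun _ => 1) (ROp := fun _ => 5 / 32) (RHist := fun _ => 9 / 4) (a := toyMajE) (r := 5 / 4) (ρ₀ := 1 / 3)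
    (B := 80) (k₀ := 5) (E₁ := 3)
    toyE_representsA toyE_representsB toyE_inBase toyE_baseBudget (by norm_num) (by norm_num)
    (fun k => by show (0 : ℝ) + 5 / 4 * (1 / 8 * 1) ≤ 5 / 32; norm_num)
    (fun k => by show (1 : ℝ) + 5 / 4 * (1 * 1) ≤ 9 / 4; norm_num)
    toyE_termRep toyE_termBound toyE_termBudget toyE_termLineAnalytic toyE_decayA toy_decayB toyER_operatorRate
    toyER_insertionRate toy_insAffine toy_insBlind toy_insHomog (toyER_insScaleBound (by norm_num)) (by norm_num)
    (by norm_num) (by norm_num) le_rfl (by norm_num) le_rfl (by norm_num) (by norm_num) (by norm_num) (by norm_num)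
    (by norm_num) (by norm_num) (fun k hk => by
      have hk' : k ≤ 4 := by omega
      calc (2 : ℝ) + 3 = 80 * (1 / 2) ^ 4 := by norm_num
        _ ≤ 80 * (1 / 2) ^ k := by
          apply mul_le_mul_of_nonneg_left _ (by norm_num)
          exact pow_le_pow_of_le_one (by norm_num) (by norm_num) hk')
    (by norm_num)

/-- [analysis] The instance's numbers: reach `8·2^{−5} + 5/1008·16 = 83/252 ≤ 1/3`, smallness `19/64 < 1/2`, and the NE5
constant `(144 + 80)·(31/64)/(13/64) = 6944/13` (huge and irrelevant: the point is that every binder of the termwise closure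
is met by a model whose output is an honest convergent expansion, and the conclusion is a genuine rate `1/2`). [folklore] -/
example : (8 : ℝ) * (1 / 2) ^ 5 + 1 / 64 * (2 + 3) / (1 - 1 / 64) = 83 / 252 ∧ (83 : ℝ) / 252 ≤ 1 / 3 ∧
    (1 : ℝ) / 64 + 12 / (1 - 1 / 3) * (1 / 64) = 19 / 64 ∧ (19 : ℝ) / 64 < 1 / 2 ∧
    ((12 : ℝ) / (1 - 1 / 3) * 8 + 12 / (1 - 1 / 3) * 0 + 80) * (1 / 2 - 1 / 64) /
      (1 / 2 - (1 / 64 + 12 / (1 - 1 / 3) * (1 / 64))) = 6944 / 13 := by norm_num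

/-- [analysis] THE ROOM IS PAID IN THE CLASS CONSTANT, visibly on the toy: with NO room (`r = 1`) the same budgets and
margins would size the class at radii `(1/8, 2)` with constant `e^{17/8} − 1 < 7.4`, against `e^{77/32} − 1 < 11.1 ≤ 12`
at `r = 5/4` — the factor booked as `ν_eff ↦ r·ν_eff` in the module docstring (here through `G`, since the toy keeps its
margins and enlarges the class; equivalently through `c` at fixed class).  Both sizes close (`1/64 + 18/64 < 1/2`); the
room is a strict but arbitrarily cheap price.  (File v1.1, §5: and it need not be paid — `toyE_ne5_termwise_slack` closes on
the radii `(1/8, 2)` with class constant `9`.) [folklore] -/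
example : (1 : ℝ) / 8 + 2 = 17 / 8 ∧ (5 : ℝ) / 32 + 9 / 4 = 77 / 32 ∧ (17 : ℝ) / 8 < 77 / 32 := by norm_num

end ToyTermwise

/-! ## §4 No room: the M-test delivers `DiffContOnCl` on the unit disc, which is all the Cauchy legs use — the weaker
## fibre-envelope shapes, their legs, their discharge from termwise data under the undilated slack, and the closures -/

section UnitDiscCl

variable {F : Type*} [NormedAddCommGroup F] [NormedSpace ℂ F]

/-- **THE UNIT-DISC TWO-POINT CAUCHY BOUND FROM `DiffContOnCl`** (the weakening of `T4InputCauchyRateData.norm_sub_le_of_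
unitDisc_near` that the termwise route needs): if `f` is complex differentiable on the OPEN unit disc, continuous on the
closed one, and bounded by `G` on the closed one, then for `0 ≤ a ≤ ρ₀ < 1`, `‖f a − f 0‖ ≤ (G/(1 − ρ₀))·a` — Cauchy's
estimate on the disc of radius `1 − ρ₀` about each point of modulus `≤ ρ₀` (whose closure stays in the closed unit disc)
and the mean-value inequality on the convex disc of radius `ρ₀`. [folklore] -/
theorem norm_sub_le_of_diffContOnCl_near {f : ℂ → F} {G ρ₀ a : ℝ} (hf : DiffContOnCl ℂ f (ball 0 1))
    (hbd : ∀ z ∈ closedBall (0 : ℂ) 1, ‖f z‖ ≤ G) (ha0 : 0 ≤ a) (hρ₀ : ρ₀ < 1) (haρ : a ≤ ρ₀) :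
    ‖f a - f 0‖ ≤ G / (1 - ρ₀) * a := by
  have hR : 0 < 1 - ρ₀ := by linarith
  have hderiv : ∀ w ∈ closedBall (0 : ℂ) ρ₀, ‖deriv f w‖ ≤ G / (1 - ρ₀) := by
    intro w hw
    rw [mem_closedBall, dist_zero_right] at hw
    have hsub : ball w (1 - ρ₀) ⊆ ball (0 : ℂ) 1 := by
      intro z hz
      rw [mem_ball, dist_eq_norm] at hz
      rw [mem_ball, dist_zero_right]
      calc ‖z‖ = ‖(z - w) + w‖ := by rw [sub_add_cancel]
        _ ≤ ‖z - w‖ + ‖w‖ := norm_add_le _ _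
        _ < 1 := by linarith
    refine Complex.norm_deriv_le_of_forall_mem_sphere_norm_le hR (hf.mono hsub) fun z hz => hbd z ?_
    rw [mem_sphere, dist_eq_norm] at hz
    rw [mem_closedBall, dist_zero_right]
    calc ‖z‖ = ‖(z - w) + w‖ := by rw [sub_add_cancel]
      _ ≤ ‖z - w‖ + ‖w‖ := norm_add_le _ _
      _ ≤ 1 := by linarith
  have hdiffAt : ∀ x ∈ closedBall (0 : ℂ) ρ₀, DifferentiableAt ℂ f x := by
    intro x hx
    rw [mem_closedBall, dist_zero_right] at hx
    exact hf.differentiableAt isOpen_ball (by rw [mem_ball, dist_zero_right]; linarith)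
  have key := (convex_closedBall (0 : ℂ) ρ₀).norm_image_sub_le_of_norm_deriv_le hdiffAt hderiv
    (mem_closedBall_self (ha0.trans haρ)) (y := (a : ℂ))
    (by rw [mem_closedBall, dist_zero_right, Complex.norm_real, Real.norm_of_nonneg ha0]; exact haρ)
  rw [sub_zero, Complex.norm_real, Real.norm_of_nonneg ha0] at key
  exact key

/-- Closed-disc differentiability implies `DiffContOnCl` on the open unit disc: the hypothesis of
`norm_sub_le_of_diffContOnCl_near` is WEAKER than that of file v5's `norm_sub_le_of_unitDisc_near`. [folklore] -/
theorem diffContOnCl_ball_of_differentiableOn_closedBall {f : ℂ → F} (hf : DifferentiableOn ℂ f (closedBall 0 1)) :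
    DiffContOnCl ℂ f (ball (0 : ℂ) 1) :=
  DifferentiableOn.diffContOnCl (by rw [closure_ball (0 : ℂ) one_ne_zero]; exact hf)

end UnitDiscCl

section Slack

variable {C : Carriers} {Op Hist : Type*} [NormedAddCommGroup Op] [NormedSpace ℂ Op] [NormedAddCommGroup Hist]
  [NormedSpace ℂ Hist] {ι : Type*} (M : StepModel C Op Hist) (K : ℕ → (ℕ → ℝ) → C.BgB → Set (Op × Hist))
  (T : ℕ → ι → Op → Hist → C.Dom → ℂ)

/-- HYPOTHESIS SHAPE `OpFibreEnvelopeCl κ G` — the WEAKER operator fibre envelope (same printed mechanism and the same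
NOT-PRINTED status as `T4InputCauchyRateData.StepModel.OpFibreEnvelope`; the only change: along each operator segment the
output is complex differentiable on the OPEN unit disc and continuous on the closed one — `DiffContOnCl` — instead of
differentiable on the closed disc; the envelope on the closed disc is unchanged).  This is exactly what a uniformly
majorised expansion with disc-analytic terms delivers (`diffContOnCl_of_termwise`), and all that the Cauchy leg uses
(`opLeg_of_opFibreEnvelopeCl`). [folklore] -/
def OpFibreEnvelopeCl (W : Set (ℕ → ℝ)) (κ G : ℝ) : Prop :=
  ∀ k, ∀ g ∈ W, ∀ (U : C.BgB) (p : Op × Hist), p ∈ M.Base k g U → ∀ X : C.Dom, C.scale X = k →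
    ∀ h ∈ closedBall p.2 (M.rHist k), ∀ u : Op, ‖u‖ ≤ M.rOp k →
      DiffContOnCl ℂ (fun ζ : ℂ => M.Out k (p.1 + ζ • u) h X) (ball 0 1) ∧
        ∀ ζ ∈ closedBall (0 : ℂ) 1, ‖M.Out k (p.1 + ζ • u) h X‖ ≤ G * Real.exp (-(κ * C.d X))

/-- HYPOTHESIS SHAPE `HistFibreEnvelopeCl κ G` — the WEAKER history fibre envelope, symmetrically (`DiffContOnCl` on the
open unit disc along each history segment within the margin, envelope on the closed disc; same printed mechanism and
NOT-PRINTED status as `T4InputCauchyRateData.StepModel.HistFibreEnvelope`). [folklore] -/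
def HistFibreEnvelopeCl (W : Set (ℕ → ℝ)) (κ G : ℝ) : Prop :=
  ∀ k, ∀ g ∈ W, ∀ (U : C.BgB) (p : Op × Hist), p ∈ M.Base k g U → ∀ X : C.Dom, C.scale X = k →
    ∀ o ∈ closedBall p.1 (M.rOp k), ∀ v : Hist, ‖v‖ ≤ M.rHist k →
      DiffContOnCl ℂ (fun ζ : ℂ => M.Out k o (p.2 + ζ • v) X) (ball 0 1) ∧
        ∀ ζ ∈ closedBall (0 : ℂ) 1, ‖M.Out k o (p.2 + ζ • v) X‖ ≤ G * Real.exp (-(κ * C.d X))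

variable {M K T}

/-- v5's operator fibre envelope implies the weaker one. [folklore] -/
theorem opFibreEnvelopeCl_of_opFibreEnvelope {W : Set (ℕ → ℝ)} {κ G : ℝ} (h : M.OpFibreEnvelope W κ G) :
    OpFibreEnvelopeCl M W κ G := fun k g hg U p hp X hX h' hh u hu =>
  ⟨diffContOnCl_ball_of_differentiableOn_closedBall (h k g hg U p hp X hX h' hh u hu).1,
    (h k g hg U p hp X hX h' hh u hu).2⟩

/-- v5's history fibre envelope implies the weaker one. [folklore] -/
theorem histFibreEnvelopeCl_of_histFibreEnvelope {W : Set (ℕ → ℝ)} {κ G : ℝ} (h : M.HistFibreEnvelope W κ G) :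
    HistFibreEnvelopeCl M W κ G := fun k g hg U p hp X hX o ho v hv =>
  ⟨diffContOnCl_ball_of_differentiableOn_closedBall (h k g hg U p hp X hX o ho v hv).1,
    (h k g hg U p hp X hX o ho v hv).2⟩

/-- THE OPERATOR LEG from the weaker envelope: `OpFibreEnvelopeCl κ Gop`, `ρ₀ < 1` ⟹
`‖Out k o h X − Out k p.1 h X‖ ≤ (Gop/(1 − ρ₀))·(‖o − p.1‖/rOp)·e^{−κd}` for `h` in the history ball and `‖o − p.1‖ ≤ ρ₀·rOp`
(`T4InputCauchyRateSpecies.opLeg_of_opFibreEnvelope` with `norm_sub_le_of_diffContOnCl_near` in place of the closed-disc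
two-point bound; same constant). [folklore] -/
theorem opLeg_of_opFibreEnvelopeCl {W : Set (ℕ → ℝ)} {κ Gop ρ₀ : ℝ} (hopF : OpFibreEnvelopeCl M W κ Gop) (hρ₀ : ρ₀ < 1) :
    ∀ k, ∀ g ∈ W, ∀ (U : C.BgB) (p : Op × Hist), p ∈ M.Base k g U → ∀ X : C.Dom, C.scale X = k →
      ∀ h ∈ closedBall p.2 (M.rHist k), ∀ o : Op, ‖o - p.1‖ ≤ ρ₀ * M.rOp k →
        ‖M.Out k o h X - M.Out k p.1 h X‖ ≤ Gop / (1 - ρ₀) * (‖o - p.1‖ / M.rOp k) * Real.exp (-(κ * C.d X)) := by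
  intro k g hg U p hp X hX h hh o ho
  have hrOp := M.rOp_pos k
  set a := ‖o - p.1‖ / M.rOp k with ha_def
  have ha0 : 0 ≤ a := by positivity
  have hqa : ‖o - p.1‖ = a * M.rOp k := by rw [ha_def, div_mul_cancel₀ _ hrOp.ne']
  have haρ : a ≤ ρ₀ := le_of_mul_le_mul_right (by rw [← hqa]; exact ho) hrOp
  rcases ha0.eq_or_lt with hzero | hpos
  · have h0 : ‖o - p.1‖ = 0 := by rw [hqa, ← hzero, zero_mul]
    rw [norm_eq_zero, sub_eq_zero] at h0
    rw [h0, sub_self, norm_zero, ← hzero, mul_zero, zero_mul]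
  · have hne : (a : ℂ) ≠ 0 := Complex.ofReal_ne_zero.mpr hpos.ne'
    set u : Op := (a : ℂ)⁻¹ • (o - p.1) with hu_def
    have hu : ‖u‖ ≤ M.rOp k := by
      rw [hu_def, norm_smul, norm_inv, Complex.norm_real, Real.norm_eq_abs, abs_of_pos hpos, hqa,
        inv_mul_cancel_left₀ hpos.ne']
    obtain ⟨hdiff, hbd⟩ := hopF k g hg U p hp X hX h hh u hu
    have hend : p.1 + (a : ℂ) • u = o := by
      rw [hu_def, smul_smul, mul_inv_cancel₀ hne, one_smul, add_sub_cancel]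
    have key := norm_sub_le_of_diffContOnCl_near hdiff hbd ha0 hρ₀ haρ
    beta_reduce at key
    rw [hend, zero_smul, add_zero] at key
    calc ‖M.Out k o h X - M.Out k p.1 h X‖ ≤ Gop * Real.exp (-(κ * C.d X)) / (1 - ρ₀) * a := key
      _ = Gop / (1 - ρ₀) * a * Real.exp (-(κ * C.d X)) := by ring

/-- THE HISTORY LEG from the weaker envelope, symmetrically. [folklore] -/
theorem histLeg_of_histFibreEnvelopeCl {W : Set (ℕ → ℝ)} {κ Ghist ρ₀ : ℝ} (hhistF : HistFibreEnvelopeCl M W κ Ghist)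
    (hρ₀ : ρ₀ < 1) :
    ∀ k, ∀ g ∈ W, ∀ (U : C.BgB) (p : Op × Hist), p ∈ M.Base k g U → ∀ X : C.Dom, C.scale X = k →
      ∀ o ∈ closedBall p.1 (M.rOp k), ∀ h : Hist, ‖h - p.2‖ ≤ ρ₀ * M.rHist k →
        ‖M.Out k o h X - M.Out k o p.2 X‖ ≤ Ghist / (1 - ρ₀) * (‖h - p.2‖ / M.rHist k) * Real.exp (-(κ * C.d X)) := by
  intro k g hg U p hp X hX o ho h hh
  have hrHist := M.rHist_pos k
  set b := ‖h - p.2‖ / M.rHist k with hb_def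
  have hb0 : 0 ≤ b := by positivity
  have hqb : ‖h - p.2‖ = b * M.rHist k := by rw [hb_def, div_mul_cancel₀ _ hrHist.ne']
  have hbρ : b ≤ ρ₀ := le_of_mul_le_mul_right (by rw [← hqb]; exact hh) hrHist
  rcases hb0.eq_or_lt with hzero | hpos
  · have h0 : ‖h - p.2‖ = 0 := by rw [hqb, ← hzero, zero_mul]
    rw [norm_eq_zero, sub_eq_zero] at h0
    rw [h0, sub_self, norm_zero, ← hzero, mul_zero, zero_mul]
  · have hne : (b : ℂ) ≠ 0 := Complex.ofReal_ne_zero.mpr hpos.ne'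
    set v : Hist := (b : ℂ)⁻¹ • (h - p.2) with hv_def
    have hv : ‖v‖ ≤ M.rHist k := by
      rw [hv_def, norm_smul, norm_inv, Complex.norm_real, Real.norm_eq_abs, abs_of_pos hpos, hqb,
        inv_mul_cancel_left₀ hpos.ne']
    obtain ⟨hdiff, hbd⟩ := hhistF k g hg U p hp X hX o ho v hv
    have hend : p.2 + (b : ℂ) • v = h := by
      rw [hv_def, smul_smul, mul_inv_cancel₀ hne, one_smul, add_sub_cancel]
    have key := norm_sub_le_of_diffContOnCl_near hdiff hbd hb0 hρ₀ hbρ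
    beta_reduce at key
    rw [hend, zero_smul, add_zero] at key
    calc ‖M.Out k o h X - M.Out k o p.2 X‖ ≤ Ghist * Real.exp (-(κ * C.d X)) / (1 - ρ₀) * b := key
      _ = Ghist / (1 - ρ₀) * b * Real.exp (-(κ * C.d X)) := by ring

/-- **THE WEAKER FIBRE ENVELOPES ⟹ THE SPECIES FORM, SAME CONSTANTS**: `OpFibreEnvelopeCl κ Gop`, `HistFibreEnvelopeCl κ Ghist`
and `ρ₀ < 1` give `DataLipschitz₂ κ (Gop/(1 − ρ₀)) (Ghist/(1 − ρ₀)) ρ₀` — literally the conclusion of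
`T4InputCauchyRateSpecies.dataLipschitz₂_of_fibreEnvelopes` from weaker hypotheses. [folklore] -/
theorem dataLipschitz₂_of_fibreEnvelopesCl {W : Set (ℕ → ℝ)} {κ Gop Ghist ρ₀ : ℝ} (hopF : OpFibreEnvelopeCl M W κ Gop)
    (hhistF : HistFibreEnvelopeCl M W κ Ghist) (hρ₀ : ρ₀ < 1) :
    DataLipschitz₂ M W κ (Gop / (1 - ρ₀)) (Ghist / (1 - ρ₀)) ρ₀ := by
  intro k g hg U p hp X hX q hq1 hq2
  have hrOp := M.rOp_pos k
  have hrHist := M.rHist_pos k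
  have leg1 := opLeg_of_opFibreEnvelopeCl hopF hρ₀ k g hg U p hp X hX p.2 (mem_closedBall_self hrHist.le) q.1 hq1
  have ho : q.1 ∈ closedBall p.1 (M.rOp k) := by
    rw [mem_closedBall, dist_eq_norm]
    calc ‖q.1 - p.1‖ ≤ ρ₀ * M.rOp k := hq1
      _ ≤ 1 * M.rOp k := mul_le_mul_of_nonneg_right hρ₀.le hrOp.le
      _ = M.rOp k := one_mul _
  have leg2 := histLeg_of_histFibreEnvelopeCl hhistF hρ₀ k g hg U p hp X hX q.1 ho q.2 hq2
  calc ‖M.Out k q.1 q.2 X - M.Out k p.1 p.2 X‖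
      = ‖(M.Out k q.1 q.2 X - M.Out k q.1 p.2 X) + (M.Out k q.1 p.2 X - M.Out k p.1 p.2 X)‖ := by
        rw [sub_add_sub_cancel]
    _ ≤ ‖M.Out k q.1 q.2 X - M.Out k q.1 p.2 X‖ + ‖M.Out k q.1 p.2 X - M.Out k p.1 p.2 X‖ := norm_add_le _ _
    _ ≤ Ghist / (1 - ρ₀) * (‖q.2 - p.2‖ / M.rHist k) * Real.exp (-(κ * C.d X)) +
        Gop / (1 - ρ₀) * (‖q.1 - p.1‖ / M.rOp k) * Real.exp (-(κ * C.d X)) := add_le_add leg2 leg1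
    _ = (Gop / (1 - ρ₀) * (‖q.1 - p.1‖ / M.rOp k) + Ghist / (1 - ρ₀) * (‖q.2 - p.2‖ / M.rHist k)) *
        Real.exp (-(κ * C.d X)) := by ring

/-! ### The M-test delivers `DiffContOnCl` from the termwise data — no room -/

/-- **TERMWISE ⟹ CONTINUITY ON THE CLOSED DISC**: along a segment whose closed unit part lies in the class, the output is
continuous on the CLOSED unit disc — a uniformly majorised series of functions continuous there (`TermLineAnalytic` gives
differentiable, hence continuous, terms on the closed disc; `TermBound` the majorants at the segment's class points;
`TermBudget` their summability; `TermRep` identifies the sum). [folklore] -/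
theorem continuousOn_closedBall_of_termwise {W : Set (ℕ → ℝ)} {κ G : ℝ} {a : ℕ → ι → ℝ} (hrep : TermRep M K T W)
    (hbd : TermBound K T W κ a) (hbud : TermBudget a G) (hline : TermLineAnalytic K T W) {k : ℕ} {g : ℕ → ℝ}
    (hg : g ∈ W) {U : C.BgB} {o u : Op} {h v : Hist}
    (hseg : ∀ ζ ∈ closedBall (0 : ℂ) 1, (o + ζ • u, h + ζ • v) ∈ K k g U) {X : C.Dom} (hX : C.scale X = k) :
    ContinuousOn (fun ζ : ℂ => M.Out k (o + ζ • u) (h + ζ • v) X) (closedBall 0 1) := by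
  have hT : ∀ i, ContinuousOn (fun ζ : ℂ => T k i (o + ζ • u) (h + ζ • v) X) (closedBall 0 1) :=
    fun i => (hline k g hg U o u h v hseg X hX i).continuousOn
  have hle : ∀ i, ∀ ζ ∈ closedBall (0 : ℂ) 1, ‖T k i (o + ζ • u) (h + ζ • v) X‖ ≤ a k i * Real.exp (-(κ * C.d X)) :=
    fun i ζ hζ => hbd k g hg U _ (hseg ζ hζ) X hX i
  have hsum := continuousOn_tsum hT ((hbud k).1.mul_right _) fun i ζ hζ => hle i ζ hζ
  exact hsum.congr fun ζ hζ => ((hrep k g hg U _ (hseg ζ hζ) X hX).tsum_eq).symm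

/-- **TERMWISE ⟹ `DiffContOnCl` ON THE UNIT DISC, WITHOUT ROOM**: differentiable inside (`differentiableOn_ball_of_termwise`)
and continuous up to the boundary (`continuousOn_closedBall_of_termwise`).  This — not closed-disc differentiability — is
the honest output of the M-test, and it is all that the Cauchy legs consume. [folklore] -/
theorem diffContOnCl_of_termwise {W : Set (ℕ → ℝ)} {κ G : ℝ} {a : ℕ → ι → ℝ} (hrep : TermRep M K T W)
    (hbd : TermBound K T W κ a) (hbud : TermBudget a G) (hline : TermLineAnalytic K T W) {k : ℕ} {g : ℕ → ℝ}
    (hg : g ∈ W) {U : C.BgB} {o u : Op} {h v : Hist}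
    (hseg : ∀ ζ ∈ closedBall (0 : ℂ) 1, (o + ζ • u, h + ζ • v) ∈ K k g U) {X : C.Dom} (hX : C.scale X = k) :
    DiffContOnCl ℂ (fun ζ : ℂ => M.Out k (o + ζ • u) (h + ζ • v) X) (ball 0 1) :=
  ⟨differentiableOn_ball_of_termwise hrep hbd hbud hline hg hseg hX, by
    rw [closure_ball (0 : ℂ) one_ne_zero]
    exact continuousOn_closedBall_of_termwise hrep hbd hbud hline hg hseg hX⟩

/-- **TERMWISE + THE UNDILATED SLACK ⟹ THE WEAKER OPERATOR FIBRE ENVELOPE** — NO ROOM: `BoxInClass M K` (the two-margin box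
itself lies in the class) and the termwise data on the class give `OpFibreEnvelopeCl κ G`. [folklore] -/
theorem opFibreEnvelopeCl_of_termwise {W : Set (ℕ → ℝ)} {κ G : ℝ} {a : ℕ → ι → ℝ} (hbox : BoxInClass M K W)
    (hrep : TermRep M K T W) (hbd : TermBound K T W κ a) (hbud : TermBudget a G) (hline : TermLineAnalytic K T W) :
    OpFibreEnvelopeCl M W κ G := by
  have hcb : ClassBound M K W κ G := classBound_of_termwise hrep hbd hbud
  intro k g hg U p hp X hX h hh u hu
  refine ⟨?_, fun ζ hζ => hcb k g hg U _ (hbox k g hg U p hp (opSegment_mem_box hh hu hζ)) X hX⟩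
  have hseg : ∀ ζ ∈ closedBall (0 : ℂ) 1, (p.1 + ζ • u, h + ζ • (0 : Hist)) ∈ K k g U :=
    fun ζ hζ => by simpa only [smul_zero, add_zero] using hbox k g hg U p hp (opSegment_mem_box hh hu hζ)
  simpa only [smul_zero, add_zero] using diffContOnCl_of_termwise hrep hbd hbud hline hg hseg hX

/-- **TERMWISE + THE UNDILATED SLACK ⟹ THE WEAKER HISTORY FIBRE ENVELOPE**, symmetrically (the exponent-critical wall W2-hist).
[folklore] -/
theorem histFibreEnvelopeCl_of_termwise {W : Set (ℕ → ℝ)} {κ G : ℝ} {a : ℕ → ι → ℝ} (hbox : BoxInClass M K W)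
    (hrep : TermRep M K T W) (hbd : TermBound K T W κ a) (hbud : TermBudget a G) (hline : TermLineAnalytic K T W) :
    HistFibreEnvelopeCl M W κ G := by
  have hcb : ClassBound M K W κ G := classBound_of_termwise hrep hbd hbud
  intro k g hg U p hp X hX o ho v hv
  refine ⟨?_, fun ζ hζ => hcb k g hg U _ (hbox k g hg U p hp (histSegment_mem_box ho hv hζ)) X hX⟩
  have hseg : ∀ ζ ∈ closedBall (0 : ℂ) 1, (o + ζ • (0 : Op), p.2 + ζ • v) ∈ K k g U :=
    fun ζ hζ => by simpa only [smul_zero, add_zero] using hbox k g hg U p hp (histSegment_mem_box ho hv hζ)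
  simpa only [smul_zero, add_zero] using diffContOnCl_of_termwise hrep hbd hbud hline hg hseg hX

/-! ### Closures without room: the same smallness and the same constant as the class closure of file v1.4 -/

/-- **NE5 AT ANY SLOWER RATE FROM THE WEAKER FIBRE ENVELOPES, SPECIES-RESOLVED** — `T4InputCauchyRateSpecies.ne5_at_of_
stepModel_fibre₂_scale_nat` from `OpFibreEnvelopeCl κ Gop` and `HistFibreEnvelopeCl κ Ghist` (same smallness
`ω + Ghist·c/(1 − ρ₀) < θ′`, same constant). [folklore] -/
theorem ne5_at_of_stepModel_fibreCl₂_scale_nat {EA : Functional C C.BgA} {EB : Functional C C.BgB} {W : Set (ℕ → ℝ)}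
    {κ Gop Ghist EA₀ E₀ E₁ δ δ' θ θ' c ω ρ₀ B : ℝ} {k₀ : ℕ} (hrA : M.RepresentsA EA W) (hrB : M.RepresentsB EB W)
    (hbase : M.InBase EB W) (hopF : OpFibreEnvelopeCl M W κ Gop) (hhistF : HistFibreEnvelopeCl M W κ Ghist)
    (hdA : DecayBound EA W EA₀ κ) (hdB : DecayBound EB W E₀ κ) (hop : M.OperatorRate W δ θ)
    (hins : M.InsertionRate W κ E₀ δ' θ) (haff : M.InsAffine W) (hblind : M.InsBlind W) (hhom : M.InsHomog W)
    (hunit : M.InsScaleBound W κ E₁ c ω) (hE₁ : 0 < E₁) (hGop : 0 ≤ Gop) (hGhist : 0 ≤ Ghist) (hδ : 0 ≤ δ)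
    (hδ' : 0 ≤ δ') (hθ : 0 ≤ θ) (hθθ' : θ ≤ θ') (hθ'1 : θ' ≤ 1) (hc : 0 ≤ c) (hω : 0 < ω) (hρ₀ : ρ₀ < 1)
    (hnear : (δ + δ') * θ ^ k₀ + c * (EA₀ + E₀) / (1 - ω) ≤ ρ₀) (hB : 0 ≤ B) (hfirst : ∀ k < k₀, EA₀ + E₀ ≤ B * θ ^ k)
    (hsmall : ω + Ghist / (1 - ρ₀) * c < θ') :
    NE5 EA EB W κ θ'
      ((Gop / (1 - ρ₀) * δ + Ghist / (1 - ρ₀) * δ' + B) * (θ' - ω) / (θ' - (ω + Ghist / (1 - ρ₀) * c))) :=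
  ne5_at_of_stepModel_lip₂_nat M hrA hrB hbase (dataLipschitz₂_of_fibreEnvelopesCl hopF hhistF hρ₀) hdA hdB hop hins
    (M.insertionDampedNat_of_affine haff (M.sizeDampedNat_of_scaleBound haff hblind hhom hunit hE₁))
    (div_nonneg hGop (by linarith)) (div_nonneg hGhist (by linarith)) hδ hδ' hθ hθθ' hθ'1 hc hω hnear hB hfirst hsmall

variable (M K T) in
/-- **NE5 FROM TERMWISE DATA AND THE UNDILATED SLACK — NO ROOM** (supersedes the census consequence of
`ne5_at_of_stepModel_termwise_scale_nat`): representation of the two runs, admissibility of run B's data, the slack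
`BoxInClass M K` ITSELF, `TermRep`, `TermBound κ a`, `TermBudget a G`, `TermLineAnalytic`, the one-run decay bounds, the
rates, the structural insertion shapes + `InsScaleBound κ E₁ c ω`, near hypothesis, first scales; smallness
`ω + G·c/(1 − ρ₀) < θ′` and constant `(G(δ + δ′)/(1 − ρ₀) + B)(θ′ − ω)/(θ′ − (ω + G·c/(1 − ρ₀)))` — EXACTLY those of
`T4InputCauchyRateSpecies.ne5_at_of_stepModel_class_scale_nat`, with `ClassLineAnalytic` replaced by the termwise data and
nothing else added. [folklore] -/
theorem ne5_at_of_stepModel_termwise_slack_scale_nat {EA : Functional C C.BgA} {EB : Functional C C.BgB}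
    {W : Set (ℕ → ℝ)} {a : ℕ → ι → ℝ} {κ G EA₀ E₀ E₁ δ δ' θ θ' c ω ρ₀ B : ℝ} {k₀ : ℕ} (hrA : M.RepresentsA EA W)
    (hrB : M.RepresentsB EB W) (hbase : M.InBase EB W) (hbox : BoxInClass M K W) (hrep : TermRep M K T W)
    (hbd : TermBound K T W κ a) (hbud : TermBudget a G) (hline : TermLineAnalytic K T W)
    (hdA : DecayBound EA W EA₀ κ) (hdB : DecayBound EB W E₀ κ) (hop : M.OperatorRate W δ θ)
    (hins : M.InsertionRate W κ E₀ δ' θ) (haff : M.InsAffine W) (hblind : M.InsBlind W) (hhom : M.InsHomog W)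
    (hunit : M.InsScaleBound W κ E₁ c ω) (hE₁ : 0 < E₁) (hG : 0 ≤ G) (hδ : 0 ≤ δ) (hδ' : 0 ≤ δ') (hθ : 0 ≤ θ)
    (hθθ' : θ ≤ θ') (hθ'1 : θ' ≤ 1) (hc : 0 ≤ c) (hω : 0 < ω) (hρ₀ : ρ₀ < 1)
    (hnear : (δ + δ') * θ ^ k₀ + c * (EA₀ + E₀) / (1 - ω) ≤ ρ₀) (hB : 0 ≤ B) (hfirst : ∀ k < k₀, EA₀ + E₀ ≤ B * θ ^ k)
    (hsmall : ω + G / (1 - ρ₀) * c < θ') :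
    NE5 EA EB W κ θ' ((G / (1 - ρ₀) * δ + G / (1 - ρ₀) * δ' + B) * (θ' - ω) / (θ' - (ω + G / (1 - ρ₀) * c))) :=
  ne5_at_of_stepModel_fibreCl₂_scale_nat hrA hrB hbase (opFibreEnvelopeCl_of_termwise hbox hrep hbd hbud hline)
    (histFibreEnvelopeCl_of_termwise hbox hrep hbd hbud hline) hdA hdB hop hins haff hblind hhom hunit hE₁ hG hG hδ hδ' hθ
    hθθ' hθ'1 hc hω hρ₀ hnear hB hfirst hsmall

variable (M T) in
/-- **NE5 FROM BUDGET AND TERMWISE DATA ON THE UNDILATED BALL CLASS — NO ROOM**: the slack from `BaseBudget ctr BOp BHist`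
with the PLAIN inequalities `BOp + rOp ≤ ROp`, `BHist + rHist ≤ RHist` (`T4InputCauchyRateSpecies.boxInClass_of_baseBudget`;
in the dilation currency of its NUMBERS (g″): `rHist = (λ − μ)E₀`, no factor), termwise data on `ballClass ctr ROp RHist`.
[folklore] -/
theorem ne5_at_of_stepModel_termwise_slack_budget_scale_nat {EA : Functional C C.BgA} {EB : Functional C C.BgB}
    {W : Set (ℕ → ℝ)} {ctr : ℕ → (ℕ → ℝ) → C.BgB → Op × Hist} {BOp BHist ROp RHist : ℕ → ℝ} {a : ℕ → ι → ℝ}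
    {κ G EA₀ E₀ E₁ δ δ' θ θ' c ω ρ₀ B : ℝ} {k₀ : ℕ} (hrA : M.RepresentsA EA W) (hrB : M.RepresentsB EB W)
    (hbase : M.InBase EB W) (hbudget : BaseBudget M W ctr BOp BHist) (hOp : ∀ k, BOp k + M.rOp k ≤ ROp k)
    (hHist : ∀ k, BHist k + M.rHist k ≤ RHist k) (hrep : TermRep M (ballClass ctr ROp RHist) T W)
    (hbd : TermBound (ballClass ctr ROp RHist) T W κ a) (hbud : TermBudget a G)
    (hline : TermLineAnalytic (ballClass ctr ROp RHist) T W) (hdA : DecayBound EA W EA₀ κ)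
    (hdB : DecayBound EB W E₀ κ) (hop : M.OperatorRate W δ θ) (hins : M.InsertionRate W κ E₀ δ' θ)
    (haff : M.InsAffine W) (hblind : M.InsBlind W) (hhom : M.InsHomog W) (hunit : M.InsScaleBound W κ E₁ c ω)
    (hE₁ : 0 < E₁) (hG : 0 ≤ G) (hδ : 0 ≤ δ) (hδ' : 0 ≤ δ') (hθ : 0 ≤ θ) (hθθ' : θ ≤ θ') (hθ'1 : θ' ≤ 1) (hc : 0 ≤ c)
    (hω : 0 < ω) (hρ₀ : ρ₀ < 1) (hnear : (δ + δ') * θ ^ k₀ + c * (EA₀ + E₀) / (1 - ω) ≤ ρ₀) (hB : 0 ≤ B)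
    (hfirst : ∀ k < k₀, EA₀ + E₀ ≤ B * θ ^ k) (hsmall : ω + G / (1 - ρ₀) * c < θ') :
    NE5 EA EB W κ θ' ((G / (1 - ρ₀) * δ + G / (1 - ρ₀) * δ' + B) * (θ' - ω) / (θ' - (ω + G / (1 - ρ₀) * c))) :=
  ne5_at_of_stepModel_termwise_slack_scale_nat M (ballClass ctr ROp RHist) T hrA hrB hbase
    (boxInClass_of_baseBudget hbudget hOp hHist) hrep hbd hbud hline hdA hdB hop hins haff hblind hhom hunit hE₁ hG hδ hδ'
    hθ hθθ' hθ'1 hc hω hρ₀ hnear hB hfirst hsmall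

end Slack

/-! ## §5 The toy again, with NO room: class radii `(1/8, 2)`, class constant `9`, the same closure numbers otherwise -/

section ToySlack

/-- `e^{17/8} − 1 ≤ 9` (`e^{17/8} ≤ e^{9/4} = (e^{3/4})³ ≤ (43/20)³ < 9.94`, from `e³ < 20.09 < (43/20)⁴`). [folklore] -/
theorem exp_classRadius₁_sub_one_le : Real.exp (17 / 8) - 1 ≤ 9 := by
  have h1 : Real.exp (17 / 8) ≤ Real.exp (9 / 4) := Real.exp_le_exp.2 (by norm_num)
  have h2 : Real.exp (9 / 4) = Real.exp (3 / 4) ^ 3 := by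
    rw [← Real.exp_nat_mul]; norm_num
  have h3 : Real.exp (3 / 4) ≤ 43 / 20 := by
    by_contra h
    rw [not_le] at h
    have h4 : (43 / 20 : ℝ) ^ 4 < Real.exp (3 / 4) ^ 4 := by gcongr
    rw [← Real.exp_nat_mul] at h4
    norm_num at h4
    have h6 : Real.exp 3 = Real.exp 1 ^ 3 := by rw [← Real.exp_nat_mul]; norm_num
    have h7 : Real.exp 1 ^ 3 < (2.7182818286 : ℝ) ^ 3 := by
      gcongr
      exact Real.exp_one_lt_d9
    norm_num at h7
    linarith
  have h5 : Real.exp (3 / 4) ^ 3 ≤ (43 / 20 : ℝ) ^ 3 := by gcongr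
  norm_num at h5
  linarith

/-- The toy's MAJORANTS on the UNDILATED ball class of radii `(1/8, 2)`: `(17/8)^{i+1}/(i+1)!`. [folklore] -/
def toyMajE₁ : ℕ → ℕ → ℝ := fun _ i => (17 / 8 : ℝ) ^ (i + 1) / ((i + 1).factorial : ℝ)

/-- Toy, no room: `TermRep` on the class of radii `(1/8, 2)`. [folklore] -/
theorem toyE₁_termRep : TermRep toyModelER (ballClass toyCtr (fun _ => 1 / 8) fun _ => 2) toyTermE Set.univ := by
  intro k g _ U q _ X _
  exact hasSum_expSeries_sub_one (q.1 + q.2)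

/-- Toy, no room: `TermBound` — on the class `‖o + h‖ ≤ 1/8 + 2 = 17/8`. [folklore] -/
theorem toyE₁_termBound : TermBound (ballClass toyCtr (fun _ => 1 / 8) fun _ => 2) toyTermE Set.univ 0 toyMajE₁ := by
  intro k g _ U q hq X _ i
  obtain ⟨hq1, hq2⟩ := Set.mem_prod.1 hq
  rw [mem_closedBall, dist_eq_norm] at hq1 hq2
  have h1 : ‖q.1‖ ≤ 1 / 8 := by simpa [toyCtr] using hq1
  have h2 : ‖q.2‖ ≤ 2 := by simpa [toyCtr] using hq2
  have hR : ‖q.1 + q.2‖ ≤ 17 / 8 := (norm_add_le _ _).trans (by linarith)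
  show ‖(q.1 + q.2) ^ (i + 1) / ((i + 1).factorial : ℂ)‖ ≤
    (17 / 8 : ℝ) ^ (i + 1) / ((i + 1).factorial : ℝ) * Real.exp (-(0 * toyCarriers.d X))
  rw [zero_mul, neg_zero, Real.exp_zero, mul_one, norm_div, norm_pow, Complex.norm_natCast]
  exact div_le_div_of_nonneg_right (pow_le_pow_left₀ (norm_nonneg _) hR _) (Nat.cast_nonneg _)

/-- Toy, no room: `TermBudget` with class constant `9 ≥ e^{17/8} − 1`. [folklore] -/
theorem toyE₁_termBudget : TermBudget toyMajE₁ 9 := by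
  intro k
  have h := hasSum_expSeries_sub_one_real (17 / 8)
  refine ⟨h.summable, ?_⟩
  show ∑' i, (17 / 8 : ℝ) ^ (i + 1) / ((i + 1).factorial : ℝ) ≤ 9
  rw [h.tsum_eq]
  exact exp_classRadius₁_sub_one_le

/-- Toy, no room: `TermLineAnalytic` (entire terms). [folklore] -/
theorem toyE₁_termLineAnalytic : TermLineAnalytic (ballClass toyCtr (fun _ => 1 / 8) fun _ => 2) toyTermE Set.univ := by
  intro k g _ U o u h v _ X _ i
  show DifferentiableOn ℂ (fun ζ : ℂ => ((o + ζ • u) + (h + ζ • v)) ^ (i + 1) / ((i + 1).factorial : ℂ))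
    (closedBall 0 1)
  apply Differentiable.differentiableOn
  simp only [smul_eq_mul]
  fun_prop

/-- **THE NO-ROOM TERMWISE CLOSURE FIRES ON THE TOY** (vacuity witness for
`ne5_at_of_stepModel_termwise_slack_budget_scale_nat`): budgets `(0, 1)`, margins `(1/8, 1)`, the PLAIN room inequalities
`0 + 1/8 ≤ 1/8`, `1 + 1 ≤ 2` into the ball class of radii `(1/8, 2)`; termwise data = the Taylor expansion of `exp(o + h) − 1`
with class constant `G = 9`; rates `δ = 8`, `δ′ = 0`, `θ = θ′ = 1/2`; gain `c = 1/64` at `ω = 1/64`, `E₁ = 3`; reach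
`ρ₀ = 1/3` from `k₀ = 5`, `B = 80`; smallness `1/64 + (9/(1 − 1/3))·(1/64) = 29/128 < 1/2`. [folklore] -/
theorem toyE_ne5_termwise_slack : NE5 toyEAE toyEB (Set.univ : Set (ℕ → ℝ)) 0 (1 / 2)
    ((9 / (1 - 1 / 3) * 8 + 9 / (1 - 1 / 3) * 0 + 80) * (1 / 2 - 1 / 64) /
      (1 / 2 - (1 / 64 + 9 / (1 - 1 / 3) * (1 / 64)))) :=
  ne5_at_of_stepModel_termwise_slack_budget_scale_nat toyModelER toyTermE (ctr := toyCtr) (BOp := fun _ => 0)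
    (BHist := fun _ => 1) (ROp := fun _ => 1 / 8) (RHist := fun _ => 2) (a := toyMajE₁) (ρ₀ := 1 / 3) (B := 80)
    (k₀ := 5) (E₁ := 3)
    toyE_representsA toyE_representsB toyE_inBase toyE_baseBudget
    (fun k => by show (0 : ℝ) + 1 / 8 * 1 ≤ 1 / 8; norm_num)
    (fun k => by show (1 : ℝ) + 1 * 1 ≤ 2; norm_num)
    toyE₁_termRep toyE₁_termBound toyE₁_termBudget toyE₁_termLineAnalytic toyE_decayA toy_decayB toyER_operatorRate
    toyER_insertionRate toy_insAffine toy_insBlind toy_insHomog (toyER_insScaleBound (by norm_num)) (by norm_num)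
    (by norm_num) (by norm_num) le_rfl (by norm_num) le_rfl (by norm_num) (by norm_num) (by norm_num) (by norm_num)
    (by norm_num) (by norm_num) (fun k hk => by
      have hk' : k ≤ 4 := by omega
      calc (2 : ℝ) + 3 = 80 * (1 / 2) ^ 4 := by norm_num
        _ ≤ 80 * (1 / 2) ^ k := by
          apply mul_le_mul_of_nonneg_left _ (by norm_num)
          exact pow_le_pow_of_le_one (by norm_num) (by norm_num) hk')
    (by norm_num)

/-- [analysis] The no-room instance's numbers: smallness `1/64 + (27/2)·(1/64) = 29/128 < 1/2` and the NE5 constant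
`(108 + 80)·(31/64)/(35/128) = 11656/35` — against `19/64` and `6944/13` of the `r = 5/4` instance `toyE_ne5_termwise`: on the
toy the room was paid in the class constant (`12` for radii `(5/32, 9/4)` against `9` for `(1/8, 2)`), and §4 returns it.
[folklore] -/
example : (1 : ℝ) / 64 + 9 / (1 - 1 / 3) * (1 / 64) = 29 / 128 ∧ (29 : ℝ) / 128 < 1 / 2 ∧
    ((9 : ℝ) / (1 - 1 / 3) * 8 + 9 / (1 - 1 / 3) * 0 + 80) * (1 / 2 - 1 / 64) /
      (1 / 2 - (1 / 64 + 9 / (1 - 1 / 3) * (1 / 64))) = 11656 / 35 := by norm_num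

end ToySlack

/-! ## §6 Exp-linear terms (file v1.2): holomorphy under the integral sign for integrands `Φ(a)·exp(Λ(a) y)` — the
## printed STRUCTURE of the resummed term (2.14), potentials ONLY through the exponential of a linear functional,
## integrated against potential-independent data — gives the per-term segment analyticity in the HISTORY species with
## no analyticity hypothesis left on that species; the operator species keeps its (species-separated) hypothesis -/

section ExpLinear

open _root_.MeasureTheory

variable {Hist : Type*} [NormedAddCommGroup Hist] [NormedSpace ℂ Hist]

/-- Pointwise domination of an exp-linear integrand: `‖Φ(a)·exp(Λ(a) y)‖ ≤ ‖Φ(a)‖·e^{N‖y‖}` when `‖Λ(a)‖ ≤ N`.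
[folklore] -/
theorem norm_mul_cexp_clm_le {Φa : ℂ} {L : Hist →L[ℂ] ℂ} {N : ℝ} (hL : ‖L‖ ≤ N) (y : Hist) :
    ‖Φa * Complex.exp (L y)‖ ≤ ‖Φa‖ * Real.exp (N * ‖y‖) := by
  rw [norm_mul, Complex.norm_exp]
  refine mul_le_mul_of_nonneg_left (Real.exp_le_exp.2 ?_) (norm_nonneg _)
  calc (L y).re ≤ ‖L y‖ := Complex.re_le_norm _
    _ ≤ ‖L‖ * ‖y‖ := L.le_opNorm y
    _ ≤ N * ‖y‖ := mul_le_mul_of_nonneg_right hL (norm_nonneg _)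

/-- **HOLOMORPHY UNDER THE INTEGRAL SIGN FOR EXP-LINEAR INTEGRANDS** — the kernel of §6: if `Φ` is integrable, each
`a ↦ Λ(a) y` is a.e. strongly measurable, and the continuous linear functionals `Λ(a)` are a.e. bounded in operator
norm by `N`, then `y ↦ ∫ Φ(a)·exp(Λ(a) y) dμ(a)` is complex differentiable on the WHOLE space (entire): on the unit
ball around `y₀` the integrand is dominated by `‖Φ(a)‖·e^{N(‖y₀‖ + 1)}`, integrable, and
`Literature.Analysis.Complex.differentiableOn_integral_of_dominated` (holomorphic dominated parameter integrals, imported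
BY NAME) applies. [folklore] -/
theorem differentiable_integral_mul_cexp_clm {α : Type*} [MeasurableSpace α] {μ : Measure α} {Φ : α → ℂ}
    {Λ : α → Hist →L[ℂ] ℂ} {N : ℝ} (hΦ : Integrable Φ μ) (hΛm : ∀ y, AEStronglyMeasurable (fun a => Λ a y) μ)
    (hΛ : ∀ᵐ a ∂μ, ‖Λ a‖ ≤ N) :
    Differentiable ℂ (fun y : Hist => ∫ a, Φ a * Complex.exp (Λ a y) ∂μ) := by
  refine differentiableOn_univ.1 (Literature.Analysis.Complex.differentiableOn_integral_of_dominated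
    (F := fun y a => Φ a * Complex.exp (Λ a y)) (fun y _ => ?_) ?_ fun y₀ _ => ?_)
  · exact hΦ.aestronglyMeasurable.mul (Complex.continuous_exp.comp_aestronglyMeasurable (hΛm y))
  · exact Filter.Eventually.of_forall fun a => Differentiable.differentiableOn (by fun_prop)
  · refine ⟨1, one_pos, subset_univ _, fun a => ‖Φ a‖ * Real.exp (N * (‖y₀‖ + 1)), hΦ.norm.mul_const _, ?_⟩
    filter_upwards [hΛ] with a ha y hy
    have hN : 0 ≤ N := (norm_nonneg _).trans ha
    have hy' : ‖y‖ ≤ ‖y₀‖ + 1 := by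
      have h1 : ‖y - y₀‖ < 1 := mem_ball_iff_norm.1 hy
      calc ‖y‖ = ‖y - y₀ + y₀‖ := by rw [sub_add_cancel]
        _ ≤ ‖y - y₀‖ + ‖y₀‖ := norm_add_le _ _
        _ ≤ ‖y₀‖ + 1 := by linarith
    calc ‖Φ a * Complex.exp (Λ a y)‖ ≤ ‖Φ a‖ * Real.exp (N * ‖y‖) := norm_mul_cexp_clm_le ha y
      _ ≤ ‖Φ a‖ * Real.exp (N * (‖y₀‖ + 1)) := by gcongr

/-- The exp-linear integral is integrable and bounded: `‖∫ Φ(a)·exp(Λ(a) y) dμ‖ ≤ (∫‖Φ‖)·e^{N‖y‖}` — the majorant has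
the shape weight × exponential of the printed termwise bounds. [folklore] -/
theorem norm_integral_mul_cexp_clm_le {α : Type*} [MeasurableSpace α] {μ : Measure α} {Φ : α → ℂ}
    {Λ : α → Hist →L[ℂ] ℂ} {N : ℝ} (hΦ : Integrable Φ μ) (hΛ : ∀ᵐ a ∂μ, ‖Λ a‖ ≤ N) (y : Hist) :
    ‖∫ a, Φ a * Complex.exp (Λ a y) ∂μ‖ ≤ (∫ a, ‖Φ a‖ ∂μ) * Real.exp (N * ‖y‖) := by
  have h : ∀ᵐ a ∂μ, ‖Φ a * Complex.exp (Λ a y)‖ ≤ ‖Φ a‖ * Real.exp (N * ‖y‖) := by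
    filter_upwards [hΛ] with a ha using norm_mul_cexp_clm_le ha y
  calc ‖∫ a, Φ a * Complex.exp (Λ a y) ∂μ‖ ≤ ∫ a, ‖Φ a‖ * Real.exp (N * ‖y‖) ∂μ :=
      norm_integral_le_of_norm_le (hΦ.norm.mul_const _) h
    _ = (∫ a, ‖Φ a‖ ∂μ) * Real.exp (N * ‖y‖) := integral_mul_const _ _

/-- **THE TECHNIQUE PER TERM, LITERALLY** (differentiate the term in the potential and bound the derivative): along a
potential segment `ζ ↦ h + ζv` the exp-linear integral has the derivative `∫ Φ(a)·exp(Λ(a)(h + ζ₀v))·Λ(a)v dμ` at every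
`ζ₀` — differentiation under the integral sign with the local domination
`‖Φ(a)‖·e^{N(‖h‖ + (‖ζ₀‖ + 1)‖v‖)}·N‖v‖` on the unit disc around `ζ₀` (Mathlib's
`hasDerivAt_integral_of_dominated_loc_of_deriv_le`).  No strip and no Cauchy estimate are needed for such a term: the
derivative is explicit. [folklore] -/
theorem hasDerivAt_integral_mul_cexp_clm_segment {α : Type*} [MeasurableSpace α] {μ : Measure α} {Φ : α → ℂ}
    {Λ : α → Hist →L[ℂ] ℂ} {N : ℝ} (hΦ : Integrable Φ μ) (hΛm : ∀ y, AEStronglyMeasurable (fun a => Λ a y) μ)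
    (hΛ : ∀ᵐ a ∂μ, ‖Λ a‖ ≤ N) (h v : Hist) (ζ₀ : ℂ) :
    HasDerivAt (fun ζ : ℂ => ∫ a, Φ a * Complex.exp (Λ a (h + ζ • v)) ∂μ)
      (∫ a, Φ a * Complex.exp (Λ a (h + ζ₀ • v)) * Λ a v ∂μ) ζ₀ := by
  have hmeas : ∀ ζ : ℂ, AEStronglyMeasurable (fun a => Φ a * Complex.exp (Λ a (h + ζ • v))) μ := fun ζ =>
    hΦ.aestronglyMeasurable.mul (Complex.continuous_exp.comp_aestronglyMeasurable (hΛm _))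
  have hlin : ∀ a, ∀ ζ : ℂ, HasDerivAt (fun ζ : ℂ => Λ a (h + ζ • v)) (Λ a v) ζ := by
    intro a ζ
    have h1 : HasDerivAt (fun ζ : ℂ => h + ζ • v) ((1 : ℂ) • v) ζ := ((hasDerivAt_id ζ).smul_const v).const_add h
    rw [one_smul] at h1
    exact (Λ a).hasFDerivAt.comp_hasDerivAt ζ h1
  have hder : ∀ a, ∀ ζ : ℂ, HasDerivAt (fun ζ : ℂ => Φ a * Complex.exp (Λ a (h + ζ • v)))
      (Φ a * Complex.exp (Λ a (h + ζ • v)) * Λ a v) ζ := by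
    intro a ζ
    have h2 := ((Complex.hasDerivAt_exp _).comp ζ (hlin a ζ)).const_mul (Φ a)
    simpa only [mul_assoc, Function.comp_def] using h2
  have hint : Integrable (fun a => Φ a * Complex.exp (Λ a (h + ζ₀ • v))) μ := by
    refine Integrable.mono' (hΦ.norm.mul_const (Real.exp (N * ‖h + ζ₀ • v‖))) (hmeas ζ₀) ?_
    filter_upwards [hΛ] with a ha using norm_mul_cexp_clm_le ha _
  refine (hasDerivAt_integral_of_dominated_loc_of_deriv_le (F' := fun ζ a => Φ a * Complex.exp (Λ a (h + ζ • v)) * Λ a v)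
    (bound := fun a => ‖Φ a‖ * Real.exp (N * (‖h‖ + (‖ζ₀‖ + 1) * ‖v‖)) * (N * ‖v‖)) (ball_mem_nhds ζ₀ one_pos)
    (Filter.Eventually.of_forall hmeas) hint ((hmeas ζ₀).mul (hΛm v)) ?_ ((hΦ.norm.mul_const _).mul_const _)
    (Filter.Eventually.of_forall fun a ζ _ => hder a ζ)).2
  filter_upwards [hΛ] with a ha ζ hζ
  have hN : 0 ≤ N := (norm_nonneg _).trans ha
  have hζ' : ‖ζ‖ ≤ ‖ζ₀‖ + 1 := by
    have h1 : ‖ζ - ζ₀‖ < 1 := mem_ball_iff_norm.1 hζ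
    calc ‖ζ‖ = ‖ζ - ζ₀ + ζ₀‖ := by rw [sub_add_cancel]
      _ ≤ ‖ζ - ζ₀‖ + ‖ζ₀‖ := norm_add_le _ _
      _ ≤ ‖ζ₀‖ + 1 := by linarith
  have hy : ‖h + ζ • v‖ ≤ ‖h‖ + (‖ζ₀‖ + 1) * ‖v‖ :=
    (norm_add_le _ _).trans (by rw [norm_smul]; gcongr)
  have hv : ‖Λ a v‖ ≤ N * ‖v‖ := (Λ a).le_of_opNorm_le ha v
  calc ‖Φ a * Complex.exp (Λ a (h + ζ • v)) * Λ a v‖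
      = ‖Φ a * Complex.exp (Λ a (h + ζ • v))‖ * ‖Λ a v‖ := norm_mul _ _
    _ ≤ ‖Φ a‖ * Real.exp (N * ‖h + ζ • v‖) * (N * ‖v‖) :=
      mul_le_mul (norm_mul_cexp_clm_le ha _) hv (norm_nonneg _) (by positivity)
    _ ≤ ‖Φ a‖ * Real.exp (N * (‖h‖ + (‖ζ₀‖ + 1) * ‖v‖)) * (N * ‖v‖) := by gcongr

end ExpLinear

section ExpLinearModel

open _root_.MeasureTheory

variable {C : Carriers} {Op Hist : Type*} [NormedAddCommGroup Op] [NormedSpace ℂ Op] [NormedAddCommGroup Hist]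
  [NormedSpace ℂ Hist] {ι : Type*} (M : StepModel C Op Hist) (K : ℕ → (ℕ → ℝ) → C.BgB → Set (Op × Hist))
  (T : ℕ → ι → Op → Hist → C.Dom → ℂ)

/-- HYPOTHESIS SHAPE `TermOpLineAnalytic K T` — the OPERATOR-species half of `TermLineAnalytic` ([analysis], NOT PRINTED;
the operators enter the resummed term (2.14) p. 15 of [II] through the `σ(Δ)`-analytic constructions of p. 5/p. 15 and
the Gaussian measures, for which no structural form is claimed here): along every complex OPERATOR segment
`ζ ↦ (o + ζu, h)` whose closed unit part lies in the class, every term is complex differentiable on the closed unit disc.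
(The wall sheet's W2-op: constant-only downstream.) [folklore] -/
def TermOpLineAnalytic (W : Set (ℕ → ℝ)) : Prop :=
  ∀ k, ∀ g ∈ W, ∀ (U : C.BgB) (o u : Op) (h : Hist),
    (∀ ζ ∈ closedBall (0 : ℂ) 1, (o + ζ • u, h) ∈ K k g U) → ∀ X : C.Dom, C.scale X = k →
      ∀ i, DifferentiableOn ℂ (fun ζ : ℂ => T k i (o + ζ • u) h X) (closedBall 0 1)

/-- HYPOTHESIS SHAPE `TermHistLineAnalytic K T` — the HISTORY-species half of `TermLineAnalytic` ([analysis] as a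
hypothesis; DISCHARGED from the structural shape `TermHistExpLinear` by `termHistLineAnalytic_of_expLinear`): along every
complex HISTORY segment `ζ ↦ (o, h + ζv)` whose closed unit part lies in the class, every term is complex differentiable
on the closed unit disc.  (The wall sheet's W2-hist: exponent-critical downstream.) [folklore] -/
def TermHistLineAnalytic (W : Set (ℕ → ℝ)) : Prop :=
  ∀ k, ∀ g ∈ W, ∀ (U : C.BgB) (o : Op) (h v : Hist),
    (∀ ζ ∈ closedBall (0 : ℂ) 1, (o, h + ζ • v) ∈ K k g U) → ∀ X : C.Dom, C.scale X = k →
      ∀ i, DifferentiableOn ℂ (fun ζ : ℂ => T k i o (h + ζ • v) X) (closedBall 0 1)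

/-- HYPOTHESIS SHAPE `TermHistExpLinear K T μ Φ Λ` — the STRUCTURAL form of the terms in the history species (printed
SUPPORT: in the resummed term (2.14) p. 15 of [II] — a product of `s(Δ)`/`σ(Δ)`- and `t(Y)`/`τ(Y)`-integrals of Cauchy
kernels, two Gaussian integrals in the auxiliary fields and characteristic functions, none of which involves the
potentials — these enter ONLY through the last factor [R] *"exp[Σ_{Y∈𝐃} τ(Y)𝐕_k(Y,B)]"*, the exponential of a combination
that is LINEAR in the potential `𝐕_k` (evaluation of the potential at a field-dependent configuration), with the `τ(Y)`
on the circles (2.18) p. 16; NOT PRINTED as a statement over an input class, and the identification of the history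
species with the potential and of `(s, σ, t, τ, X, B)` with one measure space is this lineage's DICTIONARY, [analysis]):
at every class point `q` and step-`k` domain, term `i` is `∫ Φ(a)·exp(Λ(a) q.2) dμ(a)` over a measure space
`α k i` with a measure `μ`, an integrable weight `Φ` and continuous linear functionals `Λ(a)` of the history variable that
depend on the OPERATOR point `q.1` (and on `k`, `i`, `X`) but NOT on the history point `q.2`, the `Λ(a)` weakly
measurable and a.e. bounded in operator norm. [folklore] -/
def TermHistExpLinear (W : Set (ℕ → ℝ)) {α : ℕ → ι → Type*} [∀ k i, MeasurableSpace (α k i)]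
    (μ : ∀ k i, Op → C.Dom → Measure (α k i)) (Φ : ∀ k i, Op → C.Dom → α k i → ℂ)
    (Λ : ∀ k i, Op → C.Dom → α k i → (Hist →L[ℂ] ℂ)) : Prop :=
  ∀ k, ∀ g ∈ W, ∀ (U : C.BgB) (q : Op × Hist), q ∈ K k g U → ∀ X : C.Dom, C.scale X = k → ∀ i,
    Integrable (Φ k i q.1 X) (μ k i q.1 X) ∧
      (∀ y : Hist, AEStronglyMeasurable (fun a => Λ k i q.1 X a y) (μ k i q.1 X)) ∧
        (∃ N : ℝ, ∀ᵐ a ∂(μ k i q.1 X), ‖Λ k i q.1 X a‖ ≤ N) ∧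
          T k i q.1 q.2 X = ∫ a, Φ k i q.1 X a * Complex.exp (Λ k i q.1 X a q.2) ∂(μ k i q.1 X)

variable {M K T}

/-- `TermLineAnalytic` (both species at once, file v1) implies its operator half (history direction `v = 0`).
[folklore] -/
theorem termOpLineAnalytic_of_termLineAnalytic {W : Set (ℕ → ℝ)} (hline : TermLineAnalytic K T W) :
    TermOpLineAnalytic K T W := by
  intro k g hg U o u h hseg X hX i
  have hseg' : ∀ ζ ∈ closedBall (0 : ℂ) 1, (o + ζ • u, h + ζ • (0 : Hist)) ∈ K k g U :=
    fun ζ hζ => by simpa only [smul_zero, add_zero] using hseg ζ hζ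
  simpa only [smul_zero, add_zero] using hline k g hg U o u h 0 hseg' X hX i

/-- `TermLineAnalytic` implies its history half (operator direction `u = 0`). [folklore] -/
theorem termHistLineAnalytic_of_termLineAnalytic {W : Set (ℕ → ℝ)} (hline : TermLineAnalytic K T W) :
    TermHistLineAnalytic K T W := by
  intro k g hg U o h v hseg X hX i
  have hseg' : ∀ ζ ∈ closedBall (0 : ℂ) 1, (o + ζ • (0 : Op), h + ζ • v) ∈ K k g U :=
    fun ζ hζ => by simpa only [smul_zero, add_zero] using hseg ζ hζ
  simpa only [smul_zero, add_zero] using hline k g hg U o 0 h v hseg' X hX i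

/-- **TERMWISE ⟹ `DiffContOnCl` ALONG ANY PATH WHOSE TERMS ARE DISC-ANALYTIC** (the M-test of §4, abstracted from the
segment): if the closed unit part of `γ : ℂ → Op × Hist` lies in the class and every term is complex differentiable on
the closed unit disc along `γ`, the output along `γ` is differentiable inside the unit disc and continuous up to its
boundary — dominated by `a k i · e^{−κd(X)}` at the path's class points (`TermBound`), summable weights (`TermBudget`),
the sum being the output (`TermRep`). [folklore] -/
theorem diffContOnCl_of_termwise_path {W : Set (ℕ → ℝ)} {κ G : ℝ} {a : ℕ → ι → ℝ} (hrep : TermRep M K T W)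
    (hbd : TermBound K T W κ a) (hbud : TermBudget a G) {k : ℕ} {g : ℕ → ℝ} (hg : g ∈ W) {U : C.BgB}
    {γ : ℂ → Op × Hist} (hseg : ∀ ζ ∈ closedBall (0 : ℂ) 1, γ ζ ∈ K k g U) {X : C.Dom} (hX : C.scale X = k)
    (hT : ∀ i, DifferentiableOn ℂ (fun ζ : ℂ => T k i (γ ζ).1 (γ ζ).2 X) (closedBall 0 1)) :
    DiffContOnCl ℂ (fun ζ : ℂ => M.Out k (γ ζ).1 (γ ζ).2 X) (ball 0 1) := by
  have hle : ∀ i, ∀ ζ ∈ closedBall (0 : ℂ) 1, ‖T k i (γ ζ).1 (γ ζ).2 X‖ ≤ a k i * Real.exp (-(κ * C.d X)) :=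
    fun i ζ hζ => hbd k g hg U _ (hseg ζ hζ) X hX i
  have heq : ∀ ζ ∈ closedBall (0 : ℂ) 1, ∑' i, T k i (γ ζ).1 (γ ζ).2 X = M.Out k (γ ζ).1 (γ ζ).2 X :=
    fun ζ hζ => (hrep k g hg U _ (hseg ζ hζ) X hX).tsum_eq
  refine ⟨?_, ?_⟩
  · have hsum := Complex.differentiableOn_tsum_of_summable_norm ((hbud k).1.mul_right _)
      (fun i => (hT i).mono ball_subset_closedBall) isOpen_ball
      (fun i ζ hζ => hle i ζ (ball_subset_closedBall hζ))
    exact hsum.congr fun ζ hζ => (heq ζ (ball_subset_closedBall hζ)).symm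
  · rw [closure_ball (0 : ℂ) one_ne_zero]
    have hsum := continuousOn_tsum (fun i => (hT i).continuousOn) ((hbud k).1.mul_right _) fun i ζ hζ => hle i ζ hζ
    exact hsum.congr fun ζ hζ => (heq ζ hζ).symm

/-- **TERMWISE (OPERATOR SPECIES ONLY) + THE UNDILATED SLACK ⟹ THE WEAKER OPERATOR FIBRE ENVELOPE**:
`opFibreEnvelopeCl_of_termwise` needs the per-term analyticity only along OPERATOR segments. [folklore] -/
theorem opFibreEnvelopeCl_of_termwise_op {W : Set (ℕ → ℝ)} {κ G : ℝ} {a : ℕ → ι → ℝ} (hbox : BoxInClass M K W)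
    (hrep : TermRep M K T W) (hbd : TermBound K T W κ a) (hbud : TermBudget a G) (hline : TermOpLineAnalytic K T W) :
    OpFibreEnvelopeCl M W κ G := by
  have hcb : ClassBound M K W κ G := classBound_of_termwise hrep hbd hbud
  intro k g hg U p hp X hX h hh u hu
  have hseg : ∀ ζ ∈ closedBall (0 : ℂ) 1, (p.1 + ζ • u, h) ∈ K k g U :=
    fun ζ hζ => hbox k g hg U p hp (opSegment_mem_box hh hu hζ)
  exact ⟨diffContOnCl_of_termwise_path (γ := fun ζ => (p.1 + ζ • u, h)) hrep hbd hbud hg hseg hX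
    (hline k g hg U p.1 u h hseg X hX), fun ζ hζ => hcb k g hg U _ (hseg ζ hζ) X hX⟩

/-- **TERMWISE (HISTORY SPECIES ONLY) + THE UNDILATED SLACK ⟹ THE WEAKER HISTORY FIBRE ENVELOPE** (the exponent-critical
wall W2-hist): `histFibreEnvelopeCl_of_termwise` needs the per-term analyticity only along HISTORY segments. [folklore] -/
theorem histFibreEnvelopeCl_of_termwise_hist {W : Set (ℕ → ℝ)} {κ G : ℝ} {a : ℕ → ι → ℝ} (hbox : BoxInClass M K W)
    (hrep : TermRep M K T W) (hbd : TermBound K T W κ a) (hbud : TermBudget a G)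
    (hline : TermHistLineAnalytic K T W) : HistFibreEnvelopeCl M W κ G := by
  have hcb : ClassBound M K W κ G := classBound_of_termwise hrep hbd hbud
  intro k g hg U p hp X hX o ho v hv
  have hseg : ∀ ζ ∈ closedBall (0 : ℂ) 1, (o, p.2 + ζ • v) ∈ K k g U :=
    fun ζ hζ => hbox k g hg U p hp (histSegment_mem_box ho hv hζ)
  exact ⟨diffContOnCl_of_termwise_path (γ := fun ζ => (o, p.2 + ζ • v)) hrep hbd hbud hg hseg hX
    (hline k g hg U o p.2 v hseg X hX), fun ζ hζ => hcb k g hg U _ (hseg ζ hζ) X hX⟩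

omit [NormedAddCommGroup Op] [NormedSpace ℂ Op] in
/-- **STRUCTURE ⟹ LINE, HISTORY SPECIES**: exp-linear terms are complex differentiable on the closed unit disc along every
history segment in the class — indeed along the whole complex line: the data at the segment's base point `(o, h)` (a
class point) make `y ↦ ∫ Φ·exp(Λ(a) y) dμ` ENTIRE (`differentiable_integral_mul_cexp_clm`), `ζ ↦ h + ζv` is affine, and
on the segment's class points the term IS that integral (`TermHistExpLinear`, whose data do not depend on the history
point).  No room, no strip, no hypothesis of analyticity. [folklore] -/
theorem termHistLineAnalytic_of_expLinear {W : Set (ℕ → ℝ)} {α : ℕ → ι → Type*} [∀ k i, MeasurableSpace (α k i)]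
    {μ : ∀ k i, Op → C.Dom → Measure (α k i)} {Φ : ∀ k i, Op → C.Dom → α k i → ℂ}
    {Λ : ∀ k i, Op → C.Dom → α k i → (Hist →L[ℂ] ℂ)} (hexp : TermHistExpLinear K T W μ Φ Λ) :
    TermHistLineAnalytic K T W := by
  intro k g hg U o h v hseg X hX i
  have h0 : (o, h) ∈ K k g U := by simpa only [zero_smul, add_zero] using hseg 0 (mem_closedBall_self zero_le_one)
  obtain ⟨hΦ, hΛm, ⟨N, hN⟩, -⟩ := hexp k g hg U (o, h) h0 X hX i
  have hF : Differentiable ℂ (fun y : Hist => ∫ a, Φ k i o X a * Complex.exp (Λ k i o X a y) ∂(μ k i o X)) :=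
    differentiable_integral_mul_cexp_clm hΦ hΛm hN
  have hγ : Differentiable ℂ (fun ζ : ℂ => h + ζ • v) := by fun_prop
  refine ((hF.comp hγ).differentiableOn.congr fun ζ hζ => ?_)
  exact (hexp k g hg U (o, h + ζ • v) (hseg ζ hζ) X hX i).2.2.2

/-! ### Closures: operator species termwise-analytic by hypothesis, history species exp-linear by structure -/

variable (M K T) in
/-- **NE5 FROM TERMWISE DATA, SPECIES-SEPARATED LINE HYPOTHESES AND THE UNDILATED SLACK**:
`ne5_at_of_stepModel_termwise_slack_scale_nat` with `TermLineAnalytic` replaced by the pair `TermOpLineAnalytic`,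
`TermHistLineAnalytic` (each weaker: only the matching species is moved); SAME smallness `ω + G·c/(1 − ρ₀) < θ′` and SAME
constant. [folklore] -/
theorem ne5_at_of_stepModel_termwise_split_scale_nat {EA : Functional C C.BgA} {EB : Functional C C.BgB}
    {W : Set (ℕ → ℝ)} {a : ℕ → ι → ℝ} {κ G EA₀ E₀ E₁ δ δ' θ θ' c ω ρ₀ B : ℝ} {k₀ : ℕ} (hrA : M.RepresentsA EA W)
    (hrB : M.RepresentsB EB W) (hbase : M.InBase EB W) (hbox : BoxInClass M K W) (hrep : TermRep M K T W)
    (hbd : TermBound K T W κ a) (hbud : TermBudget a G) (hlineOp : TermOpLineAnalytic K T W)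
    (hlineHist : TermHistLineAnalytic K T W) (hdA : DecayBound EA W EA₀ κ) (hdB : DecayBound EB W E₀ κ)
    (hop : M.OperatorRate W δ θ) (hins : M.InsertionRate W κ E₀ δ' θ) (haff : M.InsAffine W) (hblind : M.InsBlind W)
    (hhom : M.InsHomog W) (hunit : M.InsScaleBound W κ E₁ c ω) (hE₁ : 0 < E₁) (hG : 0 ≤ G) (hδ : 0 ≤ δ)
    (hδ' : 0 ≤ δ') (hθ : 0 ≤ θ) (hθθ' : θ ≤ θ') (hθ'1 : θ' ≤ 1) (hc : 0 ≤ c) (hω : 0 < ω) (hρ₀ : ρ₀ < 1)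
    (hnear : (δ + δ') * θ ^ k₀ + c * (EA₀ + E₀) / (1 - ω) ≤ ρ₀) (hB : 0 ≤ B) (hfirst : ∀ k < k₀, EA₀ + E₀ ≤ B * θ ^ k)
    (hsmall : ω + G / (1 - ρ₀) * c < θ') :
    NE5 EA EB W κ θ' ((G / (1 - ρ₀) * δ + G / (1 - ρ₀) * δ' + B) * (θ' - ω) / (θ' - (ω + G / (1 - ρ₀) * c))) :=
  ne5_at_of_stepModel_fibreCl₂_scale_nat hrA hrB hbase (opFibreEnvelopeCl_of_termwise_op hbox hrep hbd hbud hlineOp)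
    (histFibreEnvelopeCl_of_termwise_hist hbox hrep hbd hbud hlineHist) hdA hdB hop hins haff hblind hhom hunit hE₁ hG hG
    hδ hδ' hθ hθθ' hθ'1 hc hω hρ₀ hnear hB hfirst hsmall

variable (M K T) in
/-- **NE5 FROM TERMWISE DATA WITH EXP-LINEAR TERMS IN THE HISTORY SPECIES**: the binders of
`ne5_at_of_stepModel_termwise_slack_scale_nat` with `TermLineAnalytic` replaced by `TermOpLineAnalytic` ([analysis],
operator species) and the STRUCTURAL `TermHistExpLinear μ Φ Λ` (no analyticity hypothesis on the history species);
SAME smallness `ω + G·c/(1 − ρ₀) < θ′`, SAME constant `(G(δ + δ′)/(1 − ρ₀) + B)(θ′ − ω)/(θ′ − (ω + G·c/(1 − ρ₀)))`.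
[folklore] -/
theorem ne5_at_of_stepModel_termwise_expLinear_scale_nat {EA : Functional C C.BgA} {EB : Functional C C.BgB}
    {W : Set (ℕ → ℝ)} {a : ℕ → ι → ℝ} {α : ℕ → ι → Type*} [∀ k i, MeasurableSpace (α k i)]
    {μ : ∀ k i, Op → C.Dom → Measure (α k i)} {Φ : ∀ k i, Op → C.Dom → α k i → ℂ}
    {Λ : ∀ k i, Op → C.Dom → α k i → (Hist →L[ℂ] ℂ)} {κ G EA₀ E₀ E₁ δ δ' θ θ' c ω ρ₀ B : ℝ} {k₀ : ℕ}
    (hrA : M.RepresentsA EA W) (hrB : M.RepresentsB EB W) (hbase : M.InBase EB W) (hbox : BoxInClass M K W)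
    (hrep : TermRep M K T W) (hbd : TermBound K T W κ a) (hbud : TermBudget a G) (hlineOp : TermOpLineAnalytic K T W)
    (hexp : TermHistExpLinear K T W μ Φ Λ) (hdA : DecayBound EA W EA₀ κ) (hdB : DecayBound EB W E₀ κ)
    (hop : M.OperatorRate W δ θ) (hins : M.InsertionRate W κ E₀ δ' θ) (haff : M.InsAffine W) (hblind : M.InsBlind W)
    (hhom : M.InsHomog W) (hunit : M.InsScaleBound W κ E₁ c ω) (hE₁ : 0 < E₁) (hG : 0 ≤ G) (hδ : 0 ≤ δ)
    (hδ' : 0 ≤ δ') (hθ : 0 ≤ θ) (hθθ' : θ ≤ θ') (hθ'1 : θ' ≤ 1) (hc : 0 ≤ c) (hω : 0 < ω) (hρ₀ : ρ₀ < 1)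
    (hnear : (δ + δ') * θ ^ k₀ + c * (EA₀ + E₀) / (1 - ω) ≤ ρ₀) (hB : 0 ≤ B) (hfirst : ∀ k < k₀, EA₀ + E₀ ≤ B * θ ^ k)
    (hsmall : ω + G / (1 - ρ₀) * c < θ') :
    NE5 EA EB W κ θ' ((G / (1 - ρ₀) * δ + G / (1 - ρ₀) * δ' + B) * (θ' - ω) / (θ' - (ω + G / (1 - ρ₀) * c))) :=
  ne5_at_of_stepModel_termwise_split_scale_nat M K T hrA hrB hbase hbox hrep hbd hbud hlineOp
    (termHistLineAnalytic_of_expLinear hexp) hdA hdB hop hins haff hblind hhom hunit hE₁ hG hδ hδ' hθ hθθ' hθ'1 hc hω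
    hρ₀ hnear hB hfirst hsmall

variable (M T) in
/-- **NE5 FROM BUDGET, TERMWISE DATA AND EXP-LINEAR HISTORY TERMS ON THE UNDILATED BALL CLASS**: the budget form
(`BaseBudget ctr BOp BHist`, PLAIN room inequalities `BOp + rOp ≤ ROp`, `BHist + rHist ≤ RHist`, termwise data on
`ballClass ctr ROp RHist`) of `ne5_at_of_stepModel_termwise_expLinear_scale_nat`. [folklore] -/
theorem ne5_at_of_stepModel_termwise_expLinear_budget_scale_nat {EA : Functional C C.BgA} {EB : Functional C C.BgB}
    {W : Set (ℕ → ℝ)} {ctr : ℕ → (ℕ → ℝ) → C.BgB → Op × Hist} {BOp BHist ROp RHist : ℕ → ℝ} {a : ℕ → ι → ℝ}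
    {α : ℕ → ι → Type*} [∀ k i, MeasurableSpace (α k i)] {μ : ∀ k i, Op → C.Dom → Measure (α k i)}
    {Φ : ∀ k i, Op → C.Dom → α k i → ℂ} {Λ : ∀ k i, Op → C.Dom → α k i → (Hist →L[ℂ] ℂ)}
    {κ G EA₀ E₀ E₁ δ δ' θ θ' c ω ρ₀ B : ℝ} {k₀ : ℕ} (hrA : M.RepresentsA EA W) (hrB : M.RepresentsB EB W)
    (hbase : M.InBase EB W) (hbudget : BaseBudget M W ctr BOp BHist) (hOp : ∀ k, BOp k + M.rOp k ≤ ROp k)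
    (hHist : ∀ k, BHist k + M.rHist k ≤ RHist k) (hrep : TermRep M (ballClass ctr ROp RHist) T W)
    (hbd : TermBound (ballClass ctr ROp RHist) T W κ a) (hbud : TermBudget a G)
    (hlineOp : TermOpLineAnalytic (ballClass ctr ROp RHist) T W)
    (hexp : TermHistExpLinear (ballClass ctr ROp RHist) T W μ Φ Λ) (hdA : DecayBound EA W EA₀ κ)
    (hdB : DecayBound EB W E₀ κ) (hop : M.OperatorRate W δ θ) (hins : M.InsertionRate W κ E₀ δ' θ)
    (haff : M.InsAffine W) (hblind : M.InsBlind W) (hhom : M.InsHomog W) (hunit : M.InsScaleBound W κ E₁ c ω)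
    (hE₁ : 0 < E₁) (hG : 0 ≤ G) (hδ : 0 ≤ δ) (hδ' : 0 ≤ δ') (hθ : 0 ≤ θ) (hθθ' : θ ≤ θ') (hθ'1 : θ' ≤ 1) (hc : 0 ≤ c)
    (hω : 0 < ω) (hρ₀ : ρ₀ < 1) (hnear : (δ + δ') * θ ^ k₀ + c * (EA₀ + E₀) / (1 - ω) ≤ ρ₀) (hB : 0 ≤ B)
    (hfirst : ∀ k < k₀, EA₀ + E₀ ≤ B * θ ^ k) (hsmall : ω + G / (1 - ρ₀) * c < θ') :
    NE5 EA EB W κ θ' ((G / (1 - ρ₀) * δ + G / (1 - ρ₀) * δ' + B) * (θ' - ω) / (θ' - (ω + G / (1 - ρ₀) * c))) :=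
  ne5_at_of_stepModel_termwise_expLinear_scale_nat M (ballClass ctr ROp RHist) T hrA hrB hbase
    (boxInClass_of_baseBudget hbudget hOp hHist) hrep hbd hbud hlineOp hexp hdA hdB hop hins haff hblind hhom hunit hE₁
    hG hδ hδ' hθ hθθ' hθ'1 hc hω hρ₀ hnear hB hfirst hsmall

end ExpLinearModel

/-! ## §7 The toy with exp-linear terms: the output `exp(o + h) − 1` as the two-term family `(exp(o)·exp(h), −1)`, each
## an integral against a Dirac mass of (history-independent weight) × exp(linear functional of `h`) -/

section ToyExpLinear

open _root_.MeasureTheory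

/-- The toy's EXP-LINEAR TERM FAMILY (index type `Fin 2`): `T₀ = exp(o + h)`, `T₁ = −1`. [folklore] -/
def toyTermD : ℕ → Fin 2 → ℂ → ℂ → toyCarriers.Dom → ℂ := fun _ i o h _ => ![Complex.exp (o + h), -1] i

/-- The toy's majorants on the ball class of radii `(1/8, 2)`: `(10, 1)` (`e^{17/8} ≤ 10`). [folklore] -/
def toyMajD : ℕ → Fin 2 → ℝ := fun _ i => ![10, 1] i

/-- The toy's measure spaces: a Dirac mass on the one-point space, for every term. [folklore] -/
abbrev toyMeasD : ℕ → Fin 2 → ℂ → toyCarriers.Dom → Measure Unit := fun _ _ _ _ => Measure.dirac ()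

/-- The toy's history-independent weights: `Φ₀ = exp(o)`, `Φ₁ = −1`. [folklore] -/
def toyPhiD : ℕ → Fin 2 → ℂ → toyCarriers.Dom → Unit → ℂ := fun _ i o _ _ => ![Complex.exp o, -1] i

/-- The toy's exponents: `Λ₀ = id` (so `exp(Λ₀ h) = exp(h)`), `Λ₁ = 0`. [folklore] -/
def toyLamD : ℕ → Fin 2 → ℂ → toyCarriers.Dom → Unit → (ℂ →L[ℂ] ℂ) :=
  fun _ i _ _ _ => ![ContinuousLinearMap.id ℂ ℂ, 0] i

/-- Toy: `TermRep` — `exp(o + h) + (−1) = exp(o + h) − 1`, a finite sum. [folklore] -/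
theorem toyD_termRep : TermRep toyModelER (ballClass toyCtr (fun _ => 1 / 8) fun _ => 2) toyTermD Set.univ := by
  intro k g _ U q _ X _
  have h := hasSum_fintype fun i : Fin 2 => toyTermD k i q.1 q.2 X
  have h2 : ∑ i : Fin 2, toyTermD k i q.1 q.2 X = Complex.exp (q.1 + q.2) - 1 := by
    rw [Fin.sum_univ_two, sub_eq_add_neg]; rfl
  rw [h2] at h
  exact h

/-- Toy: `TermBound` — on the class `‖exp(o + h)‖ = e^{Re(o + h)} ≤ e^{17/8} ≤ 10` and `‖−1‖ = 1`. [folklore] -/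
theorem toyD_termBound : TermBound (ballClass toyCtr (fun _ => 1 / 8) fun _ => 2) toyTermD Set.univ 0 toyMajD := by
  intro k g _ U q hq X _ i
  obtain ⟨hq1, hq2⟩ := Set.mem_prod.1 hq
  rw [mem_closedBall, dist_eq_norm] at hq1 hq2
  have h1 : ‖q.1‖ ≤ 1 / 8 := by simpa [toyCtr] using hq1
  have h2 : ‖q.2‖ ≤ 2 := by simpa [toyCtr] using hq2
  have hR : ‖q.1 + q.2‖ ≤ 17 / 8 := (norm_add_le _ _).trans (by linarith)
  rw [zero_mul, neg_zero, Real.exp_zero, mul_one]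
  fin_cases i
  · show ‖Complex.exp (q.1 + q.2)‖ ≤ 10
    rw [Complex.norm_exp]
    calc Real.exp (q.1 + q.2).re ≤ Real.exp (17 / 8) := Real.exp_le_exp.2 ((Complex.re_le_norm _).trans hR)
      _ ≤ 10 := by linarith [exp_classRadius₁_sub_one_le]
  · show ‖(-1 : ℂ)‖ ≤ 1
    simp

/-- Toy: `TermBudget` with class constant `11 = 10 + 1`. [folklore] -/
theorem toyD_termBudget : TermBudget toyMajD 11 := by
  intro k
  refine ⟨(hasSum_fintype _).summable, ?_⟩
  rw [tsum_fintype, Fin.sum_univ_two]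
  show (10 : ℝ) + 1 ≤ 11
  norm_num

/-- Toy: `TermOpLineAnalytic` (entire terms along operator segments). [folklore] -/
theorem toyD_termOpLineAnalytic :
    TermOpLineAnalytic (ballClass toyCtr (fun _ => 1 / 8) fun _ => 2) toyTermD Set.univ := by
  intro k g _ U o u h _ X _ i
  fin_cases i
  · show DifferentiableOn ℂ (fun ζ : ℂ => Complex.exp (o + ζ • u + h)) (closedBall 0 1)
    apply Differentiable.differentiableOn
    simp only [smul_eq_mul]
    fun_prop
  · show DifferentiableOn ℂ (fun _ : ℂ => (-1 : ℂ)) (closedBall 0 1)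
    exact differentiableOn_const _

/-- Toy: `TermHistExpLinear` — `exp(o + h) = ∫ exp(o)·exp(id h) dδ`, `−1 = ∫ (−1)·exp(0 h) dδ`; weights integrable
against the Dirac mass, exponents constant in `a` with operator norms `≤ 1`. [folklore] -/
theorem toyD_termHistExpLinear : TermHistExpLinear (ballClass toyCtr (fun _ => 1 / 8) fun _ => 2) toyTermD Set.univ
    (α := fun _ _ => Unit) toyMeasD toyPhiD toyLamD := by
  intro k g _ U q _ X _ i
  fin_cases i
  · refine ⟨?_, fun y => aestronglyMeasurable_const, ⟨1, ae_of_all _ fun _ => ?_⟩, ?_⟩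
    · exact integrable_const _
    · show ‖ContinuousLinearMap.id ℂ ℂ‖ ≤ 1
      exact ContinuousLinearMap.norm_id_le
    · show Complex.exp (q.1 + q.2) =
        ∫ _a : Unit, Complex.exp q.1 * Complex.exp (ContinuousLinearMap.id ℂ ℂ q.2) ∂(Measure.dirac ())
      rw [integral_dirac, ContinuousLinearMap.id_apply, Complex.exp_add]
  · refine ⟨?_, fun y => aestronglyMeasurable_const, ⟨1, ae_of_all _ fun _ => ?_⟩, ?_⟩
    · exact integrable_const _
    · show ‖(0 : ℂ →L[ℂ] ℂ)‖ ≤ 1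
      rw [norm_zero]; exact zero_le_one
    · show (-1 : ℂ) = ∫ _a : Unit, (-1 : ℂ) * Complex.exp ((0 : ℂ →L[ℂ] ℂ) q.2) ∂(Measure.dirac ())
      rw [integral_dirac]
      simp

/-- **THE EXP-LINEAR CLOSURE FIRES ON THE TOY** (vacuity witness for
`ne5_at_of_stepModel_termwise_expLinear_budget_scale_nat`): budgets `(0, 1)`, margins `(1/8, 1)`, PLAIN room
inequalities into the ball class of radii `(1/8, 2)`; the two-term exp-linear family with majorants `(10, 1)` and class
constant `G = 11`; operator-segment analyticity of the (entire) terms; the Dirac-mass exp-linear structure in `h`; rates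
`δ = 8`, `δ′ = 0`, `θ = θ′ = 1/2`; gain `c = 1/64` at `ω = 1/64`, `E₁ = 3`; reach `ρ₀ = 1/3` from `k₀ = 5`, `B = 80`;
smallness `1/64 + (11/(1 − 1/3))·(1/64) = 35/128 < 1/2`. [folklore] -/
theorem toyE_ne5_expLinear : NE5 toyEAE toyEB (Set.univ : Set (ℕ → ℝ)) 0 (1 / 2)
    ((11 / (1 - 1 / 3) * 8 + 11 / (1 - 1 / 3) * 0 + 80) * (1 / 2 - 1 / 64) /
      (1 / 2 - (1 / 64 + 11 / (1 - 1 / 3) * (1 / 64)))) :=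
  ne5_at_of_stepModel_termwise_expLinear_budget_scale_nat toyModelER toyTermD (ctr := toyCtr) (BOp := fun _ => 0)
    (BHist := fun _ => 1) (ROp := fun _ => 1 / 8) (RHist := fun _ => 2) (a := toyMajD) (ρ₀ := 1 / 3) (B := 80)
    (k₀ := 5) (E₁ := 3)
    toyE_representsA toyE_representsB toyE_inBase toyE_baseBudget
    (fun k => by show (0 : ℝ) + 1 / 8 * 1 ≤ 1 / 8; norm_num)
    (fun k => by show (1 : ℝ) + 1 * 1 ≤ 2; norm_num)
    toyD_termRep toyD_termBound toyD_termBudget toyD_termOpLineAnalytic toyD_termHistExpLinear toyE_decayA toy_decayB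
    toyER_operatorRate toyER_insertionRate toy_insAffine toy_insBlind toy_insHomog (toyER_insScaleBound (by norm_num))
    (by norm_num) (by norm_num) (by norm_num) le_rfl (by norm_num) le_rfl (by norm_num) (by norm_num) (by norm_num)
    (by norm_num) (by norm_num) (by norm_num) (fun k hk => by
      have hk' : k ≤ 4 := by omega
      calc (2 : ℝ) + 3 = 80 * (1 / 2) ^ 4 := by norm_num
        _ ≤ 80 * (1 / 2) ^ k := by
          apply mul_le_mul_of_nonneg_left _ (by norm_num)
          exact pow_le_pow_of_le_one (by norm_num) (by norm_num) hk')
    (by norm_num)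

/-- [analysis] The exp-linear instance's numbers: smallness `1/64 + (33/2)·(1/64) = 35/128 < 1/2` and the NE5 constant
`(132 + 80)·(31/64)/(29/128) = 13144/29` — against `29/128` and `11656/35` of `toyE_ne5_termwise_slack` (Taylor terms,
class constant `9`): the coarser two-term split costs `2` in the class constant and nothing else; the point is that the
history-species analyticity binder is now met by STRUCTURE (a representation as integrals of weight × exp ∘ linear), not
by an analyticity hypothesis. [folklore] -/
example : (1 : ℝ) / 64 + 11 / (1 - 1 / 3) * (1 / 64) = 35 / 128 ∧ (35 : ℝ) / 128 < 1 / 2 ∧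
    ((11 : ℝ) / (1 - 1 / 3) * 8 + 11 / (1 - 1 / 3) * 0 + 80) * (1 / 2 - 1 / 64) /
      (1 / 2 - (1 / 64 + 11 / (1 - 1 / 3) * (1 / 64))) = 13144 / 29 := by norm_num

end ToyExpLinear

end Literature.MathematicalPhysics.QuantumFieldTheory.Balaban1983to89.T4InputCauchyRateTermwise

end
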